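import Summits.KontsevichZagierPeriods.KontsevichZagierPeriods.Theses.TerasomaMultiplication
import Literature.NumberTheory.Transcendental.KZCalculusProofs
import Literature.NumberTheory.Transcendental.KZLogCalculusProofs
import Literature.NumberTheory.Transcendental.KZRelationsLE
import Literature.NumberTheory.Transcendental.KZSubcalculusInvariants
import Literature.NumberTheory.Transcendental.KZMellinFibres
import Literature.NumberTheory.Transcendental.SemialgebraicMapsProofs
import Summits.KontsevichZagierPeriods.KontsevichZagierPeriods.Theorems.MultiplicationThree.Negative.ValueEq
import Literature.Barriers.KontsevichZagierPeriods.AlgebraicPrimitivesObstruction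

/-!
# Disproof of `MultiplicationAccessible` (stmt-KontsevichZagierPeriods-12305) — standing adversary, gen 1–3

Crux (route TerasomaMultiplication, rank 3): for every `m ≥ 1` (`n = m+1`) and rational `s > 0`,
the box representation `[(0,1)^m, ∏ᵢ xᵢ^((i+1)/n − 1)(1 − xᵢ)^(s−1)]` (value `∏_{k<n} B(k/n, s)`)
and the simplex representation `[{σ > 0, Σσ < n}, (∏σᵢ·(n − Σσᵢ))^(s−1)]` (value
`n^{ns−1}Γ(s)^n/Γ(ns)`) are `KZ.Equivalent`.

**Verdict so far: NO KILL — the crux resists every cheap attack, and any kill is a refutation of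
the formalised Conjecture 1 itself.** Findings, all theorems below sorry-free (axioms ⊆ {propext,
Classical.choice, Quot.sound}):

1. UNFOLDING (§1). `multiplicationAccessible_iff`: the crux is `∀ m ≥ 1, ∀ s > 0, At m s` with
   `At m s := ∀ r r', IsBoxRep m s r → IsSimplexRep m s r' → Equivalent r r'`; by congruence
   (`KZ.of_sub_of_mem_relations_of_eqOn`) it does not depend on the representatives
   (`at_iff_of_witnesses`): ONE box rep and ONE simplex rep per `(m, s)` decide it. No junk
   operators: `^` is `Real.rpow` with positive bases on both domains, casts `ℕ/ℚ → ℝ` only, the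
   `∏` binder extends over the whole product (read back by `rfl` in W.lean).
2. LOAD-BEARING ANALYSIS (§2, §7): **both explicit hypotheses are decorative.**
   * `1 ≤ m`: the excluded case `m = 0` is TRUE (`at_zero`: both reps are `[pt, 1]`), so
     `MultiplicationAccessible ↔ ∀ m, ∀ s > 0, At m s` (`multiplicationAccessible_iff_noGuard`).
   * `0 < s`: below it the crux is VACUOUS, not false — for `s ≤ 0` no box representation exists
     at `m = 1` (`not_isBoxRep_one_of_nonpos`: `x^{−1/2}(1−x)^{s−1}` is not absolutely integrable
     at `x = 1`, via `intervalIntegral.integrableOn_Ioo_rpow_iff` after the reflection `u = 1 − x`),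
     so `At 1 s` holds vacuously (`at_one_of_nonpos`). (General `m`: same by Fubini; not typed.)
   So there is no `_false_without_` theorem to be had: the entire content is the conclusion, and
   the only load-bearing data are the two domain/integrand pinnings — see item 5.
3. THE TORSION ESCAPE IS CLOSED (§3). The crux docstring's failure mode — "cyclicity of
   `H₁(C, cusps; ℤ)` over the group ring may hold only rationally (torsion), giving `N·(pair)`
   only" — cannot refute the STATEMENT: `FormalRep ⧸ relations` is torsion-free
   (`mem_relations_of_nsmul_mem_relations`, `…_zsmul_…`; five lines from the tree's scaling
   endomorphism `KZ.scale (1/k)` and `KZ.IntegralRep.of_constMul_nat_sub_nsmul_mem_relations`: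
   `c ≡ k • scale(1/k) c` mod relations, generatorwise `[σ,f] ≡ k•[σ,f/k]`). Hence
   `MultiplicationAccessible ↔ UpToTorsion` (`multiplicationAccessible_iff_upToTorsion`): an
   `N`-fold chain `N·([r] − [r']) ∈ relations` is as good as a chain. (This also proves route
   CoactionDevissage's support items `TorsionFree` (stmt-3169) and `Divisible` (stmt-3170,
   `c' := scale(1/n) c`, `sub_nsmul_scale_inv_mem_relations`); candidate proofs attached there.)
4. NO CHEAP KILL EXISTS (§4). `multiplicationAccessible_of_summit :
   ValueIdentity → KontsevichZagierPeriods → MultiplicationAccessible` (via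
   `KZ.exists_isRational_equivalent_holds` + `Equivalent.value_eq_holds`) and conversely
   `valueIdentity_of_multiplicationAccessible`. `ValueIdentity` (box value = simplex value) is
   Gauss's multiplication formula in Beta form — classical (AAR Thm 1.5.2), re-verified numerically
   by four refuter passes (n = 2..8, seven exponents, rel. err ≤ 1.4e-14), in Mathlib only for
   `m = 1` (Legendre). So a kill needs an ADDITIVE INVARIANT of `FormalRep` vanishing on the four
   move sets, not factoring through `eval`, and separating a box/simplex pair: it would refute the
   formalised Conjecture 1 (headline event). Candidates examined and why each fails: `eval`
   (values equal), `KZ.coeffSum` (both sides one generator: `0`), `KZ.restrictedEval` (not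
   invariant under rules 2–3; it only separates sub-calculi, item 5), dimension (rule 3 moves
   between dimensions; both reps have dimension `m`), Hodge/weight-type invariants (would need the
   open comparison "rules ≡ motives", Huber–Müller-Stach 2017 Ch. 13; motivically the two sides
   AGREE: Terasoma / Otsubo–Yamazaki arXiv:2402.06072 Thm 7.2).
5. CALIBRATION AND REFUTED VARIANTS at the first rung `(m, s) = (1, 1)` (§5, §6), with explicit
   representations `boxRepOneOne = [(0,1), x^{−1/2}]`, `simplexRepOneOne = [(0,2), 1]` (values
   `2 = 2`, `values_agree_one_one` — consistency, no evaluation kill):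
   * `not_unitSimplexVariant` — normalising the simplex side to the UNIT simplex `Σσ < 1`
     (Dirichlet form, factor `n^{ns−1}` dropped) is FALSE (`2 ≠ 1`): the scaling `Σσ < n` is
     tight; a proof carries `n^{ns−1}` as one scaling move (|det| = `n^m`) plus the rational power
     `n^{n(s−1)}` inside the integrand.
   * `not_byAdditivity` — the pair is NOT connected by the additivity moves (1a)+(1b) alone
     (separated by `KZ.restrictedEval` over the box window, `2 ≠ 1`): **every derivation uses a
     change of variables or a Newton–Leibniz move** (no scissors congruence in situ).
   * `boxRepOneOne_sub_simplexRepOneOne_mem_changeOfVariablesRel`, `at_one_one` (§8) — at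
     `(1, 1)` the pair IS ONE rule-(2) move `σ = 2√x` (`1·|dσ/dx| = x^{−1/2}`, graph `σ² = 4x`;
     all side conditions of `changeOfVariablesRel` discharged), so the crux HOLDS at the first
     rung and `coeffSum`-type obstructions ("additivity is necessary") are not available in
     general (likewise `(1, 1/2)` is one move `σ = 2x`, not typed); at `(1, s)` five moves suffice
     (route support DuplicationAllExponents; rattack note); for INTEGER `s ≥ 1` and every `m` the
     box side becomes a ℚ-polynomial integrand after the `m` Kummer dilations `xᵢ = yᵢ^n`
     (tree: `KZ.of_sub_of_mem_relations_of_boxDilation`), both values are rational, and the pair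
     is accessible by dissection + Fubini-type Newton–Leibniz moves with polynomial primitives —
     the difficulty of the crux is concentrated at NON-INTEGER `s` (transcendental Beta values),
     exactly where Terasoma's covering is needed.
6. WHY IT RESISTS (for the provers). The statement is a proper instance of the summit about a
   KNOWN identity whose motivic proof (O–Y Thm 7.2) uses invertibility of Chow motives and
   division by `(n−1)!`; item 3 shows the division is harmless in `FormalRep ⧸ relations`, so the
   only genuine gap between the printed proof and a chain of moves is EFFECTIVITY: writing
   Terasoma's correspondence `X → T ← C^{n−1}` as rule-(2) moves on injectivity cells plus Stokes
   on a pole-avoiding semialgebraic chain `W_n` (rule 3 with the form's algebraic coefficients as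
   primitives). No negative result in print bears on this (searches: see NOTES.md of this seat;
   Cresson–Viu-Sos 2022, Huber–Müller-Stach 2017 Ch. 13, Huber–Wüstholz 2022 App. A report no
   counterexample to Conjecture 1 and no accessibility claim for Gauss multiplication).
7. Targets: none handed over (gen 3 payload: `stuck_stubs = []`; the lead's line
   shifted-family-prime-sieve has 7 registered stubs, all surviving drefute; its only open stub
   `stub_oddPrimeShifted` is summit-implied, Gauss multiplication ⇒ no value kill). Near-misses: none.
8. LANDED in the tree (importable, namespace `Summit.KontsevichZagierPeriods.MultiplicationAccessible.
   Negative`; all accepted, sorry-free, std axioms): `Summits/…/Theorems/MultiplicationAccessible/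
   Negative/Core.lean` (p72767: §§1–4, §7), `…/Negative/Variants.lean` (p73418: §§5–6),
   `…/Negative/OneMove.lean` (p73744: §8). Candidate proofs of route CoactionDevissage's
   `TorsionFree` (stmt-3169) and `Divisible` (stmt-3170) attached to those items as evidence
   (`TorsionDivisible.lean`, same argument as §3). Gen 3 (§§9–10): proposed as
   `…/Negative/Structure.lean` and `…/Negative/CovFree.lean` (ids in the seat's NOTES.md).
9. (gen 3, §9) STRUCTURE. The crux CONTAINS the route's crux 2 and its duplication support item as
   literal instances: `multiplicationThree_iff_at_two : MultiplicationThree ↔ ∀ s > 0, At 2 s`,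
   `duplicationAllExponents_iff_at_one : DuplicationAllExponents ↔ ∀ s > 0, At 1 s`; hence
   `not_multiplicationAccessible_of_not_multiplicationThree`, `…_of_not_duplicationAllExponents`
   (a kill of stmt-3598 or stmt-12309 kills this crux) and
   `multiplicationAccessible_iff_dup_three_rest : MA ↔ Dup ∧ M3 ∧ (∀ m ≥ 3, ∀ s > 0, At m s)`.
10. (gen 3, §10) **RULE (2) IS NECESSARY** — refuted strengthening `not_covFreeVariant`: the box and
   simplex representations are NOT connected by additivity (1a,1b) + Newton–Leibniz (3) alone, in
   any number of auxiliary dimensions, at `(m, s) = (2, 1/3)` (the `Γ(1/3)³` pair = crux 2 at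
   `s = 1/3`; `not_mem_closure_add_nl_of_reps` for arbitrary representatives). Mechanism, reusable on
   any pair: the coordinate-`0` distribution function `cdfEval : FormalRep →+ (ℝ → ℝ)` vanishes on
   (1a), (1b), on NL moves between positive dimensions (restricted soundness
   `setIntegral_band_inter_eq`), and sends an NL move `1 → 0` to `x ↦ F(min x b) − F(a)` with `F`
   the move's `ℚ`-SEMIALGEBRAIC primitive; so `closure(1a ∪ 1b ∪ 3)` maps into the subgroup
   `piecewiseSemialg` of functions that are, off finitely many points, locally a real constant plus
   a continuous `ℚ`-semialgebraic function (`closure_add_nl_le_comap_cdfEval`). For the pair, the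
   difference is `V_box − κ·B(x/3; 1/3, 2/3)` on `(1,3)` (`cdf_pair_eq`, windowed chart
   `Φ(u,v) = (3u, 3(1−u)v)` + Fubini), and the substitution `x/3 = w³/(1+w³)` makes its derivative the
   rational differential `−3κ dw/(1+w³)` with a simple REAL pole at `w = −1` (`kern_Xf_mul_Xf'`):
   by the descent of `Literature/Barriers/…/AlgebraicPrimitivesObstruction`
   (`NoSemialgPrimKernel.eq_zero_of_evalEval_eq_zero`) no primitive is algebraic over `ℝ(w)` on any
   interval ⇒ `not_isPiecewise_pair`. WHY IT MATTERS FOR THE PROVERS: every chain for this crux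
   (already at `m = 2`) must contain a change of variables that MOVES the first coordinate — the
   Bolza line (rules 1+2) and the sieve (Dirichlet chart, `Φ`-bijection) do; any plan of the shape
   "Fubini/strip by Newton–Leibniz with admissible primitives + dissections" is dead on arrival, in
   every dimension (Ayoub Rem. 1.2 / Cresson–Viu-Sos §2.1 turned from a heuristic about one proof
   strategy into a theorem about this crux pair). The `(1, s)` rungs are different: the obstruction
   there needs `arcsin`/incomplete-Beta transcendence (no real pole), not attempted.
-/

noncomputable section

set_option linter.dupNamespace false

open MeasureTheory Set
open Literature.NumberTheory.Transcendental
open Literature.NumberTheory.Transcendental.KZ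
open Summit.KontsevichZagierPeriods.KontsevichZagierPeriods.Theses.TerasomaMultiplication
  (MultiplicationAccessible)

namespace Summit.KontsevichZagierPeriods.KontsevichZagierPeriods.Cruxes.MultiplicationAccessible.Disproof

variable {m n : ℕ} {s : ℚ}

/-! ## §1 Vocabulary, unfolding, representative-independence -/

/-- The box domain `(0,1)^m` of the crux, token for token. [folklore] -/
def boxDom (m : ℕ) : Set (Fin m → ℝ) := {x | ∀ i, x i ∈ Set.Ioo (0:ℝ) 1}

/-- The box integrand `∏ᵢ xᵢ^((i+1)/(m+1) − 1) (1 − xᵢ)^(s−1)` of the crux, token for token. [folklore] -/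
def boxFun (m : ℕ) (s : ℚ) : (Fin m → ℝ) → ℝ :=
  fun x => ∏ i : Fin m, (x i) ^ ((((i:ℕ):ℝ) + 1) / ((m:ℝ) + 1) - 1) * (1 - x i) ^ ((s:ℝ) - 1)

/-- The simplex domain `{σ > 0, Σσ < m+1}` of the crux, token for token. [folklore] -/
def simplexDom (m : ℕ) : Set (Fin m → ℝ) := {x | (∀ i, 0 < x i) ∧ ∑ i, x i < (m:ℝ) + 1}

/-- The simplex integrand `(∏σᵢ · (m+1 − Σσᵢ))^(s−1)` of the crux, token for token. [folklore] -/
def simplexFun (m : ℕ) (s : ℚ) : (Fin m → ℝ) → ℝ :=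
  fun x => ((∏ i, x i) * ((m:ℝ) + 1 - ∑ i, x i)) ^ ((s:ℝ) - 1)

/-- `r` is a box representation of the crux at `(m, s)`. [folklore] -/
def IsBoxRep (m : ℕ) (s : ℚ) (r : IntegralRep m) : Prop :=
  r.domain = boxDom m ∧ EqOn r.integrand (boxFun m s) r.domain

/-- `r'` is a simplex representation of the crux at `(m, s)`. [folklore] -/
def IsSimplexRep (m : ℕ) (s : ℚ) (r' : IntegralRep m) : Prop :=
  r'.domain = simplexDom m ∧ EqOn r'.integrand (simplexFun m s) r'.domain

/-- The instance of the crux at the parameter `(m, s)` (no guards). [folklore] -/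
def At (m : ℕ) (s : ℚ) : Prop :=
  ∀ r r' : IntegralRep m, IsBoxRep m s r → IsSimplexRep m s r' → Equivalent r r'

/-- **The crux, unfolded**: `MultiplicationAccessible` is the conjunction of its instances `At m s`
over `m ≥ 1`, `s > 0`. [folklore] -/
theorem multiplicationAccessible_iff :
    MultiplicationAccessible ↔ ∀ (m : ℕ) (s : ℚ), 1 ≤ m → 0 < s → At m s := by
  constructor
  · intro h m s hm hs r r' hr hr'
    exact h m s hm hs r r' hr.1 hr.2 hr'.1 hr'.2
  · intro h m s hm hs r r' hd hi hd' hi'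
    exact h m s hm hs r r' ⟨hd, hi⟩ ⟨hd', hi'⟩

/-- Two box representations at the same `(m, s)` differ by a relation (integrand additivity against
a zero representation): the crux does not depend on the representative. [folklore] -/
theorem IsBoxRep.of_sub_of_mem_relations {r₁ r₂ : IntegralRep m} (h₁ : IsBoxRep m s r₁)
    (h₂ : IsBoxRep m s r₂) : of r₁ - of r₂ ∈ relations :=
  of_sub_of_mem_relations_of_eqOn (by rw [h₁.1, h₂.1]) fun x hx => by
    rw [h₁.2 hx, h₂.2 (by rw [h₂.1, ← h₁.1]; exact hx)]

/-- Two simplex representations at the same `(m, s)` differ by a relation. [folklore] -/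
theorem IsSimplexRep.of_sub_of_mem_relations {r₁ r₂ : IntegralRep m} (h₁ : IsSimplexRep m s r₁)
    (h₂ : IsSimplexRep m s r₂) : of r₁ - of r₂ ∈ relations :=
  of_sub_of_mem_relations_of_eqOn (by rw [h₁.1, h₂.1]) fun x hx => by
    rw [h₁.2 hx, h₂.2 (by rw [h₂.1, ← h₁.1]; exact hx)]

/-- **Representative-independence**: given ONE box representation `r₀` and ONE simplex
representation `r₀'` at `(m, s)`, the instance `At m s` is exactly `Equivalent r₀ r₀'`. [folklore] -/
theorem at_iff_of_witnesses {r₀ r₀' : IntegralRep m} (h₀ : IsBoxRep m s r₀)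
    (h₀' : IsSimplexRep m s r₀') : At m s ↔ Equivalent r₀ r₀' := by
  refine ⟨fun h => h r₀ r₀' h₀ h₀', fun h r r' hr hr' => ?_⟩
  have h1 : Equivalent r r₀ := hr.of_sub_of_mem_relations h₀
  have h2 : Equivalent r₀' r' := h₀'.of_sub_of_mem_relations hr'
  exact h1.trans (h.trans h2)

/-! ## §2 Load-bearing analysis, part 1: the guard `1 ≤ m` is decorative -/

/-- **The excluded degenerate case `m = 0` is TRUE**: in dimension `0` both domains are the
one-point space and both integrands are `1` on it, so the two representations differ by a
relation. Hence no proof needs the guard `1 ≤ m`. [folklore] -/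
theorem at_zero (s : ℚ) : At 0 s := by
  intro r r' hr hr'
  have hd : r'.domain = r.domain := by
    rw [hr.1, hr'.1]
    ext x
    simp [boxDom, simplexDom]
  refine of_sub_of_mem_relations_of_eqOn hd fun x hx => ?_
  rw [hr.2 hx, hr'.2 (hd ▸ hx)]
  simp [boxFun, simplexFun]

/-- The crux with the guard `1 ≤ m` removed is equivalent to the crux. [folklore] -/
theorem multiplicationAccessible_iff_noGuard :
    MultiplicationAccessible ↔ ∀ (m : ℕ) (s : ℚ), 0 < s → At m s := by
  rw [multiplicationAccessible_iff]
  refine ⟨fun h m s hs => ?_, fun h m s _ hs => h m s hs⟩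
  rcases Nat.eq_zero_or_pos m with rfl | hm
  · exact at_zero s
  · exact h m s hm hs

/-! ## §3 The torsion escape is closed: `FormalRep ⧸ relations` is torsion-free -/

section Torsion

/-- The algebraic constant `1/k`. [folklore] -/
theorem isAlgebraic_inv_nat (k : ℕ) : IsAlgebraic ℚ ((k : ℝ)⁻¹) :=
  IsAlgebraic.inv_iff.mpr (isAlgebraic_nat k)

/-- Generatorwise: `[σ, f] − k • [σ, f/k]` is a relation (`[σ, k·(f/k)] − k•[σ, f/k]` is integrand
additivity, `KZ.IntegralRep.of_constMul_nat_sub_nsmul_mem_relations`, and `[σ, f] − [σ, k·(f/k)]`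
is congruence). [cite: KontsevichZagier2001, §1.2 rule (1)] -/
theorem of_sub_nsmul_of_constMul_inv_mem_relations (r : IntegralRep n) {k : ℕ} (hk : k ≠ 0) :
    of r - k • of (r.constMul ((k : ℝ)⁻¹) (isAlgebraic_inv_nat k)) ∈ relations := by
  set r₁ := r.constMul ((k : ℝ)⁻¹) (isAlgebraic_inv_nat k) with hr₁
  have h1 : of (r₁.constMul (k : ℝ) (isAlgebraic_nat k)) - k • of r₁ ∈ relations :=
    IntegralRep.of_constMul_nat_sub_nsmul_mem_relations r₁ k
  have h2 : of r - of (r₁.constMul (k : ℝ) (isAlgebraic_nat k)) ∈ relations := by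
    refine of_sub_of_mem_relations_of_eqOn rfl fun x _ => ?_
    have hk' : (k : ℝ) ≠ 0 := Nat.cast_ne_zero.mpr hk
    simp only [hr₁, IntegralRep.integrand_constMul]
    rw [← mul_assoc, mul_inv_cancel₀ hk', one_mul]
  have : of r - k • of r₁ = (of r - of (r₁.constMul (k : ℝ) (isAlgebraic_nat k))) +
      (of (r₁.constMul (k : ℝ) (isAlgebraic_nat k)) - k • of r₁) := by abel
  rw [this]
  exact relations.add_mem h2 h1

/-- Every formal combination `c` is congruent to `k • scale (1/k) c` modulo relations.
[cite: KontsevichZagier2001, §1.2 rule (1)] -/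
theorem sub_nsmul_scale_inv_mem_relations {k : ℕ} (hk : k ≠ 0) (c : FormalRep) :
    c - k • scale ((k : ℝ)⁻¹) (isAlgebraic_inv_nat k) c ∈ relations := by
  induction c using FreeAbelianGroup.induction_on with
  | zero => simp
  | of x =>
    obtain ⟨n, r⟩ := x
    change of r - k • scale ((k : ℝ)⁻¹) (isAlgebraic_inv_nat k) (of r) ∈ relations
    rw [scale_of]
    exact of_sub_nsmul_of_constMul_inv_mem_relations r hk
  | neg x hx =>
    obtain ⟨n, r⟩ := x
    change -of r - k • scale ((k : ℝ)⁻¹) (isAlgebraic_inv_nat k) (-of r) ∈ relations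
    have : -of r - k • scale ((k : ℝ)⁻¹) (isAlgebraic_inv_nat k) (-of r) =
        -(of r - k • scale ((k : ℝ)⁻¹) (isAlgebraic_inv_nat k) (of r)) := by
      rw [map_neg, smul_neg]; abel
    rw [this]
    exact relations.neg_mem hx
  | add x y hx hy =>
    have : x + y - k • scale ((k : ℝ)⁻¹) (isAlgebraic_inv_nat k) (x + y) =
        (x - k • scale ((k : ℝ)⁻¹) (isAlgebraic_inv_nat k) x) +
        (y - k • scale ((k : ℝ)⁻¹) (isAlgebraic_inv_nat k) y) := by
      rw [map_add, smul_add]; abel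
    rw [this]
    exact relations.add_mem hx hy

/-- **`FormalRep ⧸ relations` is torsion-free** (route CoactionDevissage's support item
`TorsionFree`, proved here in five lines from the scaling endomorphism `KZ.scale (1/k)`):
if `k • c` is a relation for some `k ≠ 0`, then `c` is a relation — although "division by an
integer" is not a rule. Consequence for this crux: the failure mode "only `N·([r] − [r'])` is
derivable" named in the crux docstring CANNOT refute the statement; an `N`-fold chain is as good
as a chain. [cite: KontsevichZagier2001, §1.2] -/
theorem mem_relations_of_nsmul_mem_relations {k : ℕ} (hk : k ≠ 0) {c : FormalRep}
    (h : k • c ∈ relations) : c ∈ relations := by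
  have h1 := sub_nsmul_scale_inv_mem_relations hk c
  have h2 : k • scale ((k : ℝ)⁻¹) (isAlgebraic_inv_nat k) c ∈ relations := by
    rw [← map_nsmul]
    exact scale_mem_relations _ _ h
  simpa using relations.add_mem h1 h2

/-- Integer version of torsion-freeness. [cite: KontsevichZagier2001, §1.2] -/
theorem mem_relations_of_zsmul_mem_relations {k : ℤ} (hk : k ≠ 0) {c : FormalRep}
    (h : k • c ∈ relations) : c ∈ relations := by
  have hk0 : k.natAbs ≠ 0 := by simpa using hk
  rcases Int.natAbs_eq k with hk' | hk'
  · rw [hk', natCast_zsmul] at h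
    exact mem_relations_of_nsmul_mem_relations hk0 h
  · rw [hk', neg_smul, natCast_zsmul] at h
    exact mem_relations_of_nsmul_mem_relations hk0 (relations.neg_mem_iff.mp h)

/-- The crux "up to torsion" (a WEAKENING, refuted as a weakening below: it is equivalent to the
crux): some non-zero multiple of `[box] − [simplex]` is a relation. -/
def UpToTorsion : Prop :=
  ∀ (m : ℕ) (s : ℚ), 1 ≤ m → 0 < s → ∀ r r' : IntegralRep m, IsBoxRep m s r → IsSimplexRep m s r' →
    ∃ N : ℕ, N ≠ 0 ∧ N • (of r - of r') ∈ relations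

/-- **The natural weakening "up to torsion" is NOT weaker**: it is equivalent to the crux. So the
integrality worry of the route ("O–Y divide by (n−1)! and invert motives: then only
N·([r]−[r']) ∈ relations") is harmless for the STATEMENT (it may still shape the chain). [folklore] -/
theorem multiplicationAccessible_iff_upToTorsion : MultiplicationAccessible ↔ UpToTorsion := by
  rw [multiplicationAccessible_iff]
  refine ⟨fun h m s hm hs r r' hr hr' => ⟨1, one_ne_zero, ?_⟩, fun h m s hm hs r r' hr hr' => ?_⟩
  · rw [one_nsmul]
    exact h m s hm hs r r' hr hr'
  obtain ⟨N, hN, hmem⟩ := h m s hm hs r r' hr hr'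
  exact mem_relations_of_nsmul_mem_relations hN hmem

end Torsion

/-! ## §4 No cheap kill: a refutation of the crux refutes the summit -/

/-- The value identity behind the crux, in representation form: Gauss's multiplication formula in
Beta form, `∏_{k=1}^{m} B(k/(m+1), s) = (m+1)^{(m+1)s−1} Γ(s)^{m+1} / Γ((m+1)s)` = the Dirichlet
value of the simplex side (classical: Andrews–Askey–Roy 1999 Thm 1.5.2; NOT in Mathlib beyond
`m = 1`). A HYPOTHESIS of the reduction below, not asserted. -/
def ValueIdentity : Prop :=
  ∀ (m : ℕ) (s : ℚ), 1 ≤ m → 0 < s → ∀ r r' : IntegralRep m, IsBoxRep m s r → IsSimplexRep m s r' →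
    r.value = r'.value

/-- The crux implies the value identity (soundness of the calculus, proved in the tree). [folklore] -/
theorem valueIdentity_of_multiplicationAccessible (h : MultiplicationAccessible) : ValueIdentity :=
  fun m s hm hs r r' hr hr' =>
    Equivalent.value_eq_holds ((multiplicationAccessible_iff.mp h) m s hm hs r r' hr hr')

/-- **The crux is an instance of the summit** given the (classical) value identity: every
representation is equivalent to one of KZ's rational shape (`KZ.exists_isRational_equivalent_holds`,
one Newton–Leibniz graph move), values are preserved, and the summit connects the two rational
representatives. Hence `¬ MultiplicationAccessible → ¬ KontsevichZagierPeriods` (given Gauss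
multiplication): any kill here is a refutation of the formalised Conjecture 1 — it needs an additive
invariant of `FormalRep` vanishing on all four move sets and separating a box/simplex pair, and no
such invariant is known. [cite: KontsevichZagier2001, §1.2 Conjecture 1] -/
theorem multiplicationAccessible_of_summit (hV : ValueIdentity) (hS : KontsevichZagierPeriods) :
    MultiplicationAccessible := by
  rw [multiplicationAccessible_iff]
  intro m s hm hs r r' hr hr'
  obtain ⟨k, ρ, hρ, hrρ⟩ := exists_isRational_equivalent_holds r
  obtain ⟨k', ρ', hρ', hr'ρ'⟩ := exists_isRational_equivalent_holds r'
  have hv : ρ.value = ρ'.value := by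
    rw [← Equivalent.value_eq_holds hrρ, ← Equivalent.value_eq_holds hr'ρ']
    exact hV m s hm hs r r' hr hr'
  exact hrρ.trans ((hS ρ ρ' hρ hρ' hv).trans hr'ρ'.symm)


/-! ## §5 Dimension-1 calibration (`m = 1`, duplication): infrastructure and values -/

section DimOne

open Literature.ModelTheory.ExponentialFields (IsSemialgebraic)
open MvPolynomial (X C aeval)

/-- The coordinate `x ↦ x 0` on `ℝ¹` is the measurable equivalence `funUnique`. [folklore] -/
theorem funUnique_apply (x : Fin 1 → ℝ) : MeasurableEquiv.funUnique (Fin 1) ℝ x = x 0 := by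
  simp [MeasurableEquiv.funUnique, Fin.default_eq_zero]

/-- The ray-simplex domain `{x | (∀ i, 0 < x i) ∧ ∑ x i < c}` in dimension `1`. [folklore] -/
def raySimplexDom (c : ℝ) : Set (Fin 1 → ℝ) := {x | (∀ i, 0 < x i) ∧ ∑ i, x i < c}

/-- In dimension `1` the box is the preimage of `(0, 1)`. [folklore] -/
theorem boxDom_one_eq : boxDom 1 = MeasurableEquiv.funUnique (Fin 1) ℝ ⁻¹' Ioo 0 1 := by
  ext x
  simp [boxDom, MeasurableEquiv.funUnique, Fin.forall_fin_one, Fin.default_eq_zero]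

/-- In dimension `1` the ray simplex is the preimage of `(0, c)`. [folklore] -/
theorem raySimplexDom_eq (c : ℝ) :
    raySimplexDom c = MeasurableEquiv.funUnique (Fin 1) ℝ ⁻¹' Ioo 0 c := by
  ext x
  simp [raySimplexDom, MeasurableEquiv.funUnique, Fin.forall_fin_one, Fin.default_eq_zero]

/-- The crux's simplex domain at `m = 1` is the ray simplex `(0, 2)`. [folklore] -/
theorem simplexDom_one : simplexDom 1 = raySimplexDom 2 := by
  ext x
  simp only [simplexDom, raySimplexDom, Nat.cast_one, mem_setOf_eq]
  norm_num

/-- The box is `ℚ`-semialgebraic (tree: `KZ.isSemialgebraic_box`). [folklore] -/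
theorem isSemialgebraic_boxDom (m : ℕ) : IsSemialgebraic ℚ (boxDom m) := isSemialgebraic_box m

/-- The box is measurable. [folklore] -/
theorem measurableSet_boxDom (m : ℕ) : MeasurableSet (boxDom m) :=
  IsSemialgebraic.measurableSet_holds (isSemialgebraic_boxDom m)

/-- The ray simplex with rational end is `ℚ`-semialgebraic. [folklore] -/
theorem isSemialgebraic_raySimplexDom (c : ℚ) : IsSemialgebraic ℚ (raySimplexDom (c : ℝ)) := by
  have h1 := Literature.ModelTheory.ExponentialFields.isSemialgebraic_setOf_eval_pos (k := ℚ)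
    (R := ℝ) (X 0 : MvPolynomial (Fin 1) ℚ)
  have h2 := Literature.ModelTheory.ExponentialFields.isSemialgebraic_setOf_eval_lt (k := ℚ)
    (R := ℝ) (X 0 : MvPolynomial (Fin 1) ℚ) (C c : MvPolynomial (Fin 1) ℚ)
  simp only [MvPolynomial.aeval_X, MvPolynomial.aeval_C, eq_ratCast] at h1 h2
  convert h1.inter h2 using 1
  ext x
  simp [raySimplexDom, Fin.forall_fin_one]

/-- **Dimension-1 representation from a function of one real variable** on a domain `D ⊆ ℝ¹` which
is the preimage of `I ⊆ ℝ` under `x ↦ x 0`: integrability is transported along the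
measure-preserving `funUnique`. [folklore] -/
def dimOneRep (D : Set (Fin 1 → ℝ)) (I : Set ℝ) (hD : D = MeasurableEquiv.funUnique (Fin 1) ℝ ⁻¹' I)
    (hDs : IsSemialgebraic ℚ D) (h : ℝ → ℝ) (hh : IsSemialgebraicFunOn ℚ D fun x => h (x 0))
    (hint : IntegrableOn h I) : IntegralRep 1 where
  domain := D
  integrand x := h (x 0)
  isSemialgebraic_domain := hDs
  isSemialgebraicFunOn_integrand := hh
  integrableOn := by
    rw [hD]
    exact ((volume_preserving_funUnique (Fin 1) ℝ).integrableOn_comp_preimage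
      (MeasurableEquiv.measurableEmbedding _)).mpr hint

/-- The value of a dimension-1 representation is the one-variable integral. [folklore] -/
theorem dimOneRep_value (D : Set (Fin 1 → ℝ)) (I : Set ℝ)
    (hD : D = MeasurableEquiv.funUnique (Fin 1) ℝ ⁻¹' I) (hDs : IsSemialgebraic ℚ D) (h : ℝ → ℝ)
    (hh : IsSemialgebraicFunOn ℚ D fun x => h (x 0)) (hint : IntegrableOn h I) :
    (dimOneRep D I hD hDs h hh hint).value = ∫ t in I, h t := by
  change ∫ x in D, h (x 0) = _
  rw [hD, ← (volume_preserving_funUnique (Fin 1) ℝ).setIntegral_preimage_emb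
    (MeasurableEquiv.measurableEmbedding _) h I]
  rfl

/-- A set integral over `D` of a function of `x 0`, transported to `ℝ`. [folklore] -/
theorem setIntegral_dimOne (D : Set (Fin 1 → ℝ)) (I : Set ℝ)
    (hD : D = MeasurableEquiv.funUnique (Fin 1) ℝ ⁻¹' I) (h : ℝ → ℝ) :
    ∫ x in D, h (x 0) = ∫ t in I, h t := by
  rw [hD, ← (volume_preserving_funUnique (Fin 1) ℝ).setIntegral_preimage_emb
    (MeasurableEquiv.measurableEmbedding _) h I]
  rfl

/-- `x ↦ (x 0)^a` with rational `a` is `ℚ`-semialgebraic on every `ℚ`-semialgebraic set of positive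
points (tree: `KZ.isSemialgebraicFunOn_mellinIntegrand` with the one-member family `X 0`).
[folklore] -/
theorem isSemialgebraicFunOn_rpow_coord {D : Set (Fin 1 → ℝ)} (hDs : IsSemialgebraic ℚ D)
    (hpos : ∀ x ∈ D, 0 < x 0) (a : ℚ) :
    IsSemialgebraicFunOn ℚ D fun x => (x 0) ^ (a : ℝ) := by
  have h := isSemialgebraicFunOn_mellinIntegrand hDs (fun _ : Fin 1 => (X 0 : MvPolynomial (Fin 1) ℚ))
    (fun _ => a) 1 (fun x hx _ => by simpa using hpos x hx)
  refine h.congr fun x _ => ?_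
  simp [mellinIntegrand]

/-- Constants are `ℚ`-semialgebraic functions (as functions of `x 0`). [folklore] -/
theorem isSemialgebraicFunOn_const_coord {D : Set (Fin 1 → ℝ)} (hDs : IsSemialgebraic ℚ D) (q : ℚ) :
    IsSemialgebraicFunOn ℚ D fun x => (fun _ : ℝ => (q : ℝ)) (x 0) :=
  (isSemialgebraicFunOn_aeval hDs (C q : MvPolynomial (Fin 1) ℚ)).congr fun x _ => by
    simp [eq_ratCast]

/-- `∫₀¹ t^a dt = 1/(a+1)` for `a > −1`. [folklore] -/
theorem setIntegral_rpow_Ioo_zero_one {a : ℝ} (ha : -1 < a) :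
    ∫ t in Ioo (0:ℝ) 1, t ^ a = 1 / (a + 1) := by
  rw [← integral_Ioc_eq_integral_Ioo, ← intervalIntegral.integral_of_le zero_le_one,
    integral_rpow (Or.inl ha)]
  have : a + 1 ≠ 0 := by linarith
  simp [Real.zero_rpow this]

/-- `t ↦ t^a` is integrable on `(0,1)` for `a > −1`. [folklore] -/
theorem integrableOn_rpow_Ioo_zero_one {a : ℝ} (ha : -1 < a) :
    IntegrableOn (fun t : ℝ => t ^ a) (Ioo (0:ℝ) 1) :=
  (intervalIntegral.integrableOn_Ioo_rpow_iff zero_lt_one).mpr ha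

/-- **The box representation at `(m, s) = (1, 1)`**: `[(0,1), x^(−1/2)]`. [folklore] -/
def boxRepOneOne : IntegralRep 1 :=
  dimOneRep (boxDom 1) (Ioo 0 1) boxDom_one_eq (isSemialgebraic_boxDom 1)
    (fun t => t ^ (((-1)/2 : ℚ) : ℝ))
    (isSemialgebraicFunOn_rpow_coord (isSemialgebraic_boxDom 1) (fun x hx => (hx 0).1) _)
    (by
      have : (((-1)/2 : ℚ) : ℝ) = -1/2 := by push_cast; ring
      rw [this]
      exact integrableOn_rpow_Ioo_zero_one (by norm_num))

/-- `boxRepOneOne` is a box representation of the crux at `(1, 1)`. [folklore] -/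
theorem isBoxRep_boxRepOneOne : IsBoxRep 1 1 boxRepOneOne := by
  refine ⟨rfl, fun x hx => ?_⟩
  have hx0 : 0 < x 0 ∧ x 0 < 1 := hx 0
  simp only [boxRepOneOne, dimOneRep, boxFun, Fin.prod_univ_one, Fin.val_zero, Nat.cast_zero,
    Nat.cast_one, Rat.cast_one, sub_self, Real.rpow_zero, mul_one]
  norm_num

/-- The value of `boxRepOneOne` is `2` (`= B(1/2, 1)`). [folklore] -/
theorem boxRepOneOne_value : boxRepOneOne.value = 2 := by
  rw [boxRepOneOne, dimOneRep_value]
  have : (((-1)/2 : ℚ) : ℝ) = -1/2 := by push_cast; ring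
  rw [this, setIntegral_rpow_Ioo_zero_one (by norm_num)]
  norm_num

/-- **The simplex representation at `(m, s) = (1, 1)`**: `[(0,2), 1]`. [folklore] -/
def simplexRepOneOne : IntegralRep 1 :=
  dimOneRep (simplexDom 1) (Ioo 0 2) (by rw [simplexDom_one, raySimplexDom_eq])
    (by rw [simplexDom_one]; exact_mod_cast isSemialgebraic_raySimplexDom 2)
    (fun _ => ((1 : ℚ) : ℝ))
    (isSemialgebraicFunOn_const_coord
      (by rw [simplexDom_one]; exact_mod_cast isSemialgebraic_raySimplexDom 2) 1)
    (integrableOn_const (by simp))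

/-- `simplexRepOneOne` is a simplex representation of the crux at `(1, 1)`. [folklore] -/
theorem isSimplexRep_simplexRepOneOne : IsSimplexRep 1 1 simplexRepOneOne := by
  refine ⟨rfl, fun x _ => ?_⟩
  simp [simplexRepOneOne, dimOneRep, simplexFun]

/-- The value of `simplexRepOneOne` is `2` (the length of `(0, 2)`). [folklore] -/
theorem simplexRepOneOne_value : simplexRepOneOne.value = 2 := by
  rw [simplexRepOneOne, dimOneRep_value]
  simp

/-- **No evaluation kill at `(1, 1)`**: both values are `2` (consistency of the crux with
soundness at the first rung; the general identity is Gauss multiplication, `ValueIdentity`). [folklore] -/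
theorem values_agree_one_one : boxRepOneOne.value = simplexRepOneOne.value := by
  rw [boxRepOneOne_value, simplexRepOneOne_value]

end DimOne

/-! ## §6 Refuted variants and strengthenings -/

section Variants

open Literature.ModelTheory.ExponentialFields (IsSemialgebraic)

/-- VARIANT (tightness of the normalisation): the simplex side normalised to the UNIT simplex
`{σ > 0, Σσ < 1}` with integrand `(∏σ · (1 − Σσ))^(s−1)` (the Dirichlet form, value
`Γ(s)^n/Γ(ns)` — the factor `n^{ns−1}` dropped); refuted below. -/
def UnitSimplexVariant : Prop :=
  ∀ (m : ℕ) (s : ℚ), 1 ≤ m → 0 < s → ∀ (r r' : IntegralRep m),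
    r.domain = {x | ∀ i, x i ∈ Set.Ioo (0:ℝ) 1} → Set.EqOn r.integrand (boxFun m s) r.domain →
    r'.domain = {x | (∀ i, 0 < x i) ∧ ∑ i, x i < 1} →
    Set.EqOn r'.integrand (fun x => ((∏ i, x i) * (1 - ∑ i, x i)) ^ ((s:ℝ) - 1)) r'.domain →
    Equivalent r r'

/-- The unit-simplex representation at `(1, 1)`: `[(0,1), 1]`, value `1`. [folklore] -/
def unitSimplexRepOneOne : IntegralRep 1 :=
  dimOneRep (raySimplexDom 1) (Ioo 0 1) (raySimplexDom_eq 1)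
    (by exact_mod_cast isSemialgebraic_raySimplexDom 1) (fun _ => ((1 : ℚ) : ℝ))
    (isSemialgebraicFunOn_const_coord (by exact_mod_cast isSemialgebraic_raySimplexDom 1) 1)
    (integrableOn_const (by simp))

/-- The value of `unitSimplexRepOneOne` is `1`. [folklore] -/
theorem unitSimplexRepOneOne_value : unitSimplexRepOneOne.value = 1 := by
  rw [unitSimplexRepOneOne, dimOneRep_value]
  simp

/-- **The unit-simplex normalisation is FALSE** (witness `(m, s) = (1, 1)`: box value `2`, unit
simplex value `1`, separated by `KZ.eval`): the scaling `Σσ < n` of the crux is forced; any proof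
must carry the constant `n^{ns−1}` through the chain (one scaling move `σ = nτ`, |det| = n^m, plus
the rational power `n^{n(s−1)}` absorbed into the integrand). [folklore] -/
theorem not_unitSimplexVariant : ¬ UnitSimplexVariant := by
  intro h
  have hEq : Equivalent boxRepOneOne unitSimplexRepOneOne := by
    refine h 1 1 le_rfl one_pos boxRepOneOne unitSimplexRepOneOne isBoxRep_boxRepOneOne.1
      isBoxRep_boxRepOneOne.2 ?_ ?_
    · change raySimplexDom 1 = _
      ext x
      simp [raySimplexDom]
    · intro x _
      simp [unitSimplexRepOneOne, dimOneRep]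
  have hv := Equivalent.value_eq_holds hEq
  rw [boxRepOneOne_value, unitSimplexRepOneOne_value] at hv
  norm_num at hv

/-- STRENGTHENING (sub-calculus): box ~ simplex by the ADDITIVITY moves (1a) + (1b) alone;
refuted below. -/
def ByAdditivity : Prop :=
  ∀ (m : ℕ) (s : ℚ), 1 ≤ m → 0 < s → ∀ r r' : IntegralRep m, IsBoxRep m s r → IsSimplexRep m s r' →
    of r - of r' ∈ AddSubgroup.closure (domainAddRel ∪ integrandAddRel)

/-- Restricted evaluation over the box window: the box representation at `(1,1)` keeps its full
value `2`. [folklore] -/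
theorem restrictedEval_boxRepOneOne : restrictedEval boxDom (of boxRepOneOne) = 2 := by
  rw [restrictedEval_of, ← boxRepOneOne_value]
  change ∫ x in boxDom 1 ∩ boxDom 1, _ = _
  rw [Set.inter_self]
  rfl

/-- Restricted evaluation over the box window: the simplex representation at `(1,1)` restricted
to `(0,1)` has value `1`. [folklore] -/
theorem restrictedEval_simplexRepOneOne : restrictedEval boxDom (of simplexRepOneOne) = 1 := by
  rw [restrictedEval_of]
  change ∫ x in simplexDom 1 ∩ boxDom 1, (fun _ : ℝ => ((1 : ℚ) : ℝ)) (x 0) = 1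
  have hsub : simplexDom 1 ∩ boxDom 1 = boxDom 1 := by
    rw [Set.inter_eq_right]
    intro x hx
    refine ⟨fun i => (hx i).1, ?_⟩
    simp only [Fin.sum_univ_one, Nat.cast_one]
    linarith [(hx 0).2]
  rw [hsub, setIntegral_dimOne (boxDom 1) (Ioo 0 1) boxDom_one_eq (fun _ => ((1 : ℚ) : ℝ))]
  simp

/-- **Additivity alone is FALSE** (witness `(1, 1)`, separated by the tree's invariant
`KZ.restrictedEval` over the box window, `2 ≠ 1`): the box and the simplex representation are not
scissors-congruent in situ — **every derivation uses a change of variables or a Newton–Leibniz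
move**. [folklore] -/
theorem not_byAdditivity : ¬ ByAdditivity := by
  intro h
  have hmem := h 1 1 le_rfl one_pos boxRepOneOne simplexRepOneOne isBoxRep_boxRepOneOne
    isSimplexRep_simplexRepOneOne
  have hker := closure_add_le_ker_restrictedEval boxDom measurableSet_boxDom hmem
  rw [AddMonoidHom.mem_ker, map_sub, restrictedEval_boxRepOneOne, restrictedEval_simplexRepOneOne]
    at hker
  norm_num at hker

end Variants


/-! ## §7 Load-bearing analysis, part 2: below the guard `0 < s` the crux is VACUOUS -/

section Vacuity

/-- The box integrand at `m = 1` as a function of `t = x 0`: `t^(−1/2) (1 − t)^(s−1)`. [folklore] -/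
theorem boxFun_one_apply (s : ℚ) (x : Fin 1 → ℝ) :
    boxFun 1 s x = (x 0) ^ (-(1:ℝ)/2) * (1 - x 0) ^ ((s:ℝ) - 1) := by
  simp only [boxFun, Fin.prod_univ_one, Fin.val_zero, Nat.cast_zero, Nat.cast_one]
  norm_num

/-- **No box representation exists at `m = 1` for `s ≤ 0`**: absolute convergence (the field
`integrableOn`) fails at `x = 1`, since `x^(−1/2)(1−x)^(s−1) ≥ (1−x)^(s−1)` on `(0,1)` and
`u ↦ u^(s−1)` is not integrable at `0⁺` for `s − 1 ≤ −1` (`intervalIntegral.integrableOn_Ioo_rpow_iff`).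
Hence the instance `At 1 s` is vacuously TRUE for `s ≤ 0`: dropping the guard `0 < s` does not
produce a counterexample — the guard is the honest convergence range, not a load-bearing
hypothesis. [folklore] -/
theorem not_isBoxRep_one_of_nonpos (hs : s ≤ 0) (r : IntegralRep 1) : ¬ IsBoxRep 1 s r := by
  rintro ⟨hd, hi⟩
  have h1 : IntegrableOn (boxFun 1 s) (boxDom 1) := by
    rw [← hd]
    exact r.integrableOn.congr_fun hi (IntegralRep.measurableSet_domain_holds r)
  -- transport to one real variable
  have h2 : IntegrableOn (fun t : ℝ => t ^ (-(1:ℝ)/2) * (1 - t) ^ ((s:ℝ) - 1)) (Ioo 0 1) := by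
    refine ((volume_preserving_funUnique (Fin 1) ℝ).integrableOn_comp_preimage
      (MeasurableEquiv.measurableEmbedding _)).mp ?_
    rw [← boxDom_one_eq]
    refine h1.congr_fun (fun x _ => ?_) (measurableSet_boxDom 1)
    rw [boxFun_one_apply]
    rfl
  -- lower bound by the pure power of `1 - t`
  have h3 : IntegrableOn (fun t : ℝ => (1 - t) ^ ((s:ℝ) - 1)) (Ioo 0 1) := by
    refine Integrable.mono' h2 ?_ ?_
    · exact ContinuousOn.aestronglyMeasurable
        (fun t ht => (Real.continuousAt_rpow_const _ _ (Or.inl (by linarith [ht.2]))).continuousWithinAt.comp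
          (continuousWithinAt_const.sub continuousWithinAt_id) (mapsTo_univ _ _))
        measurableSet_Ioo
    · filter_upwards [ae_restrict_mem measurableSet_Ioo] with t ht
      have hpos : 0 ≤ (1 - t) ^ ((s:ℝ) - 1) := Real.rpow_nonneg (by linarith [ht.2]) _
      rw [Real.norm_of_nonneg hpos]
      have hone : 1 ≤ t ^ (-(1:ℝ)/2) :=
        Real.one_le_rpow_of_pos_of_le_one_of_nonpos ht.1 ht.2.le (by norm_num)
      calc (1 - t) ^ ((s:ℝ) - 1) = 1 * (1 - t) ^ ((s:ℝ) - 1) := (one_mul _).symm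
        _ ≤ t ^ (-(1:ℝ)/2) * (1 - t) ^ ((s:ℝ) - 1) := mul_le_mul_of_nonneg_right hone hpos
  -- reflect `u = 1 - t`
  have h4 : IntegrableOn (fun u : ℝ => u ^ ((s:ℝ) - 1)) (Ioo 0 1) := by
    have h3' : IntervalIntegrable (fun t : ℝ => (1 - t) ^ ((s:ℝ) - 1)) volume 0 1 :=
      (intervalIntegrable_iff_integrableOn_Ioo_of_le zero_le_one).mpr h3
    have h4' := (h3'.comp_sub_left 1).symm
    simp only [sub_sub_cancel, sub_zero, sub_self] at h4'
    exact (intervalIntegrable_iff_integrableOn_Ioo_of_le zero_le_one).mp h4'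
  have h5 := (intervalIntegral.integrableOn_Ioo_rpow_iff zero_lt_one).mp h4
  have hs' : (s:ℝ) ≤ 0 := by exact_mod_cast hs
  linarith

/-- Consequently the instance at `m = 1` holds VACUOUSLY for every `s ≤ 0`. [folklore] -/
theorem at_one_of_nonpos (hs : s ≤ 0) : At 1 s :=
  fun r _ hr _ => (not_isBoxRep_one_of_nonpos hs r hr).elim

end Vacuity


/-! ## §8 Positive calibration: the first rung `(1, 1)` is ONE change of variables -/

section OneMove

open Literature.ModelTheory.ExponentialFields (IsSemialgebraic)
open MvPolynomial (X C aeval)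

/-- The substitution `σ = 2√x` on `ℝ¹`. [folklore] -/
def sqrtMap (x : Fin 1 → ℝ) : Fin 1 → ℝ := fun _ => 2 * Real.sqrt (x 0)

/-- Its derivative at `x` (for `x 0 > 0`): `v ↦ (√(x 0))⁻¹ • v`. [folklore] -/
def sqrtMapDeriv (x : Fin 1 → ℝ) : (Fin 1 → ℝ) →L[ℝ] (Fin 1 → ℝ) :=
  (Real.sqrt (x 0))⁻¹ • ContinuousLinearMap.id ℝ (Fin 1 → ℝ)

/-- Coordinates of `Fin.append` on `ℝ¹ × ℝ¹`. [folklore] -/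
theorem append_fin_one_apply_zero (x y : Fin 1 → ℝ) : Fin.append x y 0 = x 0 :=
  Fin.append_left x y 0

/-- Coordinates of `Fin.append` on `ℝ¹ × ℝ¹`. [folklore] -/
theorem append_fin_one_apply_one (x y : Fin 1 → ℝ) : Fin.append x y 1 = y 0 :=
  Fin.append_right x y 0

/-- The graph of `σ = 2√x` over the box is cut out by `0 < x < 1`, `σ > 0`, `σ² − 4x = 0`. [folklore] -/
theorem graph_sqrtMap_eq :
    {z : Fin (1 + 1) → ℝ | ∃ x ∈ boxDom 1, z = Fin.append x (sqrtMap x)} =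
      {z | 0 < z 0 ∧ z 0 < 1 ∧ 0 < z 1 ∧ z 1 ^ 2 - 4 * z 0 = 0} := by
  ext z
  simp only [mem_setOf_eq]
  constructor
  · rintro ⟨x, hx, rfl⟩
    have hx0 : 0 < x 0 ∧ x 0 < 1 := hx 0
    rw [append_fin_one_apply_zero, append_fin_one_apply_one]
    refine ⟨hx0.1, hx0.2, mul_pos two_pos (Real.sqrt_pos.mpr hx0.1), ?_⟩
    simp only [sqrtMap, mul_pow, Real.sq_sqrt hx0.1.le]
    ring
  · rintro ⟨h0, h1, h2, h3⟩
    refine ⟨fun _ => z 0, fun _ => ⟨h0, h1⟩, ?_⟩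
    have hs : Real.sqrt (z 0) = z 1 / 2 := by
      rw [Real.sqrt_eq_iff_eq_sq h0.le (by positivity)]
      nlinarith
    funext i
    fin_cases i
    · exact (append_fin_one_apply_zero (fun _ => z 0) (sqrtMap fun _ => z 0)).symm
    · change z 1 = Fin.append (fun _ => z 0) (sqrtMap fun _ => z 0) 1
      rw [append_fin_one_apply_one]
      simp only [sqrtMap, hs]
      ring

/-- `σ = 2√x` is a `ℚ`-semialgebraic map on the box. [folklore] -/
theorem isSemialgebraicMapOn_sqrtMap : IsSemialgebraicMapOn ℚ (boxDom 1) sqrtMap := by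
  unfold IsSemialgebraicMapOn
  rw [graph_sqrtMap_eq]
  have h0 := Literature.ModelTheory.ExponentialFields.isSemialgebraic_setOf_eval_pos (k := ℚ)
    (R := ℝ) (X 0 : MvPolynomial (Fin (1 + 1)) ℚ)
  have h1 := Literature.ModelTheory.ExponentialFields.isSemialgebraic_setOf_eval_pos (k := ℚ)
    (R := ℝ) (1 - X 0 : MvPolynomial (Fin (1 + 1)) ℚ)
  have h2 := Literature.ModelTheory.ExponentialFields.isSemialgebraic_setOf_eval_pos (k := ℚ)
    (R := ℝ) (X 1 : MvPolynomial (Fin (1 + 1)) ℚ)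
  have h3 := Literature.ModelTheory.ExponentialFields.isSemialgebraic_setOf_eval_eq_zero (k := ℚ)
    (R := ℝ) (X 1 ^ 2 - C 4 * X 0 : MvPolynomial (Fin (1 + 1)) ℚ)
  simp only [MvPolynomial.aeval_X, map_sub, map_one, map_mul, map_pow, MvPolynomial.aeval_C,
    eq_ratCast, sub_pos] at h0 h1 h2 h3
  convert ((h0.inter h1).inter h2).inter h3 using 1
  ext z
  simp only [mem_setOf_eq, mem_inter_iff]
  push_cast
  tauto

/-- `σ = 2√x` has derivative `sqrtMapDeriv x` at every point of the box. [folklore] -/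
theorem hasFDerivAt_sqrtMap {x : Fin 1 → ℝ} (hx : 0 < x 0) :
    HasFDerivAt sqrtMap (sqrtMapDeriv x) x := by
  have h1 : HasFDerivAt (fun y : Fin 1 → ℝ => y 0) (ContinuousLinearMap.proj 0) x :=
    hasFDerivAt_apply (𝕜 := ℝ) 0 x
  have h2 : HasDerivAt (fun t : ℝ => 2 * Real.sqrt t) (2 * (1 / (2 * Real.sqrt (x 0)))) (x 0) :=
    (Real.hasDerivAt_sqrt hx.ne').const_mul 2
  have h3 := h2.hasFDerivAt.comp x h1
  refine hasFDerivAt_pi'' fun i => ?_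
  have hL : (ContinuousLinearMap.proj i).comp (sqrtMapDeriv x) =
      (ContinuousLinearMap.toSpanSingleton ℝ (2 * (1 / (2 * Real.sqrt (x 0))))).comp
        (ContinuousLinearMap.proj 0) := by
    refine ContinuousLinearMap.ext fun v => ?_
    have hs : Real.sqrt (x 0) ≠ 0 := (Real.sqrt_pos.mpr hx).ne'
    rw [Subsingleton.elim i 0]
    simp only [sqrtMapDeriv, ContinuousLinearMap.coe_comp, Function.comp_apply,
      FunLike.coe_smul, Pi.smul_apply, ContinuousLinearMap.coe_id', id_eq,
      smul_eq_mul, ContinuousLinearMap.proj_apply, ContinuousLinearMap.toSpanSingleton_apply]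
    field_simp
  rw [hL]
  exact h3

/-- The Jacobian determinant of `σ = 2√x` is `(√x)⁻¹`. [folklore] -/
theorem det_sqrtMapDeriv (x : Fin 1 → ℝ) : (sqrtMapDeriv x).det = (Real.sqrt (x 0))⁻¹ := by
  have h : ((sqrtMapDeriv x : (Fin 1 → ℝ) →L[ℝ] (Fin 1 → ℝ)) : (Fin 1 → ℝ) →ₗ[ℝ] (Fin 1 → ℝ)) =
      (Real.sqrt (x 0))⁻¹ • LinearMap.id := by
    refine LinearMap.ext fun v => funext fun i => ?_
    simp [sqrtMapDeriv]
  change LinearMap.det ((sqrtMapDeriv x : (Fin 1 → ℝ) →L[ℝ] (Fin 1 → ℝ)) :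
    (Fin 1 → ℝ) →ₗ[ℝ] (Fin 1 → ℝ)) = _
  rw [h, LinearMap.det_smul, LinearMap.det_id, Module.finrank_fin_fun]
  simp

/-- **The `(1, 1)` rung is a single rule-(2) move**: `[(0,1), x^{−1/2}] − [(0,2), 1] ∈
changeOfVariablesRel` along `σ = 2√x` (`|dσ/dx| = x^{−1/2}`). So the sub-calculus of rules
(2)+(3) suffices here — "additivity is necessary" is NOT a property of the family (contrast
`not_byAdditivity`). [cite: KontsevichZagier2001, §1.2 rule (2)] -/
theorem boxRepOneOne_sub_simplexRepOneOne_mem_changeOfVariablesRel :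
    of boxRepOneOne - of simplexRepOneOne ∈ changeOfVariablesRel := by
  refine ⟨1, boxRepOneOne, simplexRepOneOne, sqrtMap, sqrtMapDeriv, isSemialgebraicMapOn_sqrtMap,
    fun x hx => (hasFDerivAt_sqrtMap (hx 0).1).hasFDerivWithinAt, ?_, ?_, ?_, rfl⟩
  · -- injectivity
    intro x hx y hy hxy
    have hx0 : 0 < x 0 := (hx 0).1
    have hy0 : 0 < y 0 := (hy 0).1
    have h := congrFun hxy 0
    simp only [sqrtMap, mul_eq_mul_left_iff, OfNat.ofNat_ne_zero, or_false] at h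
    have h' : x 0 = y 0 := by
      have := congrArg (fun t => t ^ 2) h
      simpa [Real.sq_sqrt hx0.le, Real.sq_sqrt hy0.le] using this
    funext i
    rw [Subsingleton.elim i 0]
    exact h'
  · -- image
    change simplexDom 1 = sqrtMap '' boxDom 1
    ext y
    simp only [simplexDom, Nat.cast_one, mem_setOf_eq, mem_image, Fin.forall_fin_one,
      Fin.sum_univ_one]
    constructor
    · rintro ⟨hy0, hy2⟩
      refine ⟨fun _ => (y 0 / 2) ^ 2, fun _ => ⟨by positivity, ?_⟩, ?_⟩
      · have : y 0 / 2 < 1 := by linarith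
        have h0 : 0 ≤ y 0 / 2 := by positivity
        nlinarith
      · funext i
        rw [Subsingleton.elim i 0]
        simp only [sqrtMap]
        rw [Real.sqrt_sq (by positivity)]
        ring
    · rintro ⟨x, hx, rfl⟩
      have hx0 := hx 0
      simp only [sqrtMap]
      refine ⟨by have := Real.sqrt_pos.mpr hx0.1; positivity, ?_⟩
      have : Real.sqrt (x 0) < 1 := by
        rw [← Real.sqrt_one]
        exact Real.sqrt_lt_sqrt hx0.1.le hx0.2
      linarith
  · -- integrand identity `x^{-1/2} = 1 · |det|`
    intro x hx
    have hx0 : 0 < x 0 := (hx 0).1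
    rw [det_sqrtMapDeriv, abs_of_pos (inv_pos.mpr (Real.sqrt_pos.mpr hx0))]
    change (x 0) ^ ((((-1) / 2 : ℚ) : ℝ)) = ((1 : ℚ) : ℝ) * (Real.sqrt (x 0))⁻¹
    rw [Real.sqrt_eq_rpow, ← Real.rpow_neg hx0.le]
    push_cast
    norm_num

/-- **The crux holds at `(1, 1)`** (by one move). [folklore] -/
theorem at_one_one : At 1 1 :=
  (at_iff_of_witnesses isBoxRep_boxRepOneOne isSimplexRep_simplexRepOneOne).mpr
    (changeOfVariablesRel_subset_relations boxRepOneOne_sub_simplexRepOneOne_mem_changeOfVariablesRel)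

end OneMove


/-! ## §9 (gen 3) The crux CONTAINS cruxes `MultiplicationThree` (stmt-3598, `m = 2`) and
`DuplicationAllExponents` (stmt-12309, `m = 1`) as instances -/

section Structure

open Summit.KontsevichZagierPeriods.KontsevichZagierPeriods.Theses.TerasomaMultiplication
  (MultiplicationThree DuplicationAllExponents)

/-- The box integrand of the crux at `m = 2`, written out. [folklore] -/
theorem boxFun_two_apply (s : ℚ) (x : Fin 2 → ℝ) :
    boxFun 2 s x = (x 0) ^ (-(2:ℝ)/3) * (1 - x 0) ^ ((s:ℝ) - 1) * (x 1) ^ (-(1:ℝ)/3) *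
      (1 - x 1) ^ ((s:ℝ) - 1) := by
  simp only [boxFun, Fin.prod_univ_two, Fin.val_zero, Fin.val_one, Nat.cast_zero, Nat.cast_one,
    Nat.cast_ofNat]
  have h0 : ((0:ℝ) + 1) / (2 + 1) - 1 = -(2:ℝ)/3 := by norm_num
  have h1 : ((1:ℝ) + 1) / (2 + 1) - 1 = -(1:ℝ)/3 := by norm_num
  rw [h0, h1]
  ring

/-- The simplex domain of the crux at `m = 2`, written out. [folklore] -/
theorem simplexDom_two : simplexDom 2 = {x : Fin 2 → ℝ | 0 < x 0 ∧ 0 < x 1 ∧ x 0 + x 1 < 3} := by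
  ext x
  simp only [simplexDom, mem_setOf_eq, Fin.forall_fin_two, Fin.sum_univ_two, Nat.cast_ofNat]
  constructor
  · rintro ⟨⟨h0, h1⟩, h⟩
    exact ⟨h0, h1, by linarith⟩
  · rintro ⟨h0, h1, h⟩
    exact ⟨⟨h0, h1⟩, by linarith⟩

/-- The simplex integrand of the crux at `m = 2`, written out. [folklore] -/
theorem simplexFun_two_apply (s : ℚ) (x : Fin 2 → ℝ) :
    simplexFun 2 s x = (x 0 * x 1 * (3 - x 0 - x 1)) ^ ((s:ℝ) - 1) := by
  simp only [simplexFun, Fin.prod_univ_two, Fin.sum_univ_two, Nat.cast_ofNat]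
  congr 1
  ring

/-- **`MultiplicationThree` is the instance `m = 2` of the crux.** [folklore] -/
theorem multiplicationThree_iff_at_two : MultiplicationThree ↔ ∀ s : ℚ, 0 < s → At 2 s := by
  constructor
  · intro h s hs r r' hr hr'
    refine h s hs r r' hr.1 (fun x hx => ?_) (hr'.1.trans simplexDom_two) (fun x hx => ?_)
    · rw [hr.2 hx, boxFun_two_apply]
    · rw [hr'.2 hx, simplexFun_two_apply]
  · intro h s hs r r' hd hi hd' hi'
    refine h s hs r r' ⟨hd, fun x hx => ?_⟩ ⟨hd'.trans simplexDom_two.symm, fun x hx => ?_⟩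
    · rw [hi hx, boxFun_two_apply]
    · rw [hi' hx, simplexFun_two_apply]

/-- **A refutation of `MultiplicationThree` (crux 2 of the route) refutes the crux**: the crux
at `m = 2` is `MultiplicationThree`. [folklore] -/
theorem not_multiplicationAccessible_of_not_multiplicationThree (h : ¬ MultiplicationThree) :
    ¬ MultiplicationAccessible :=
  fun hA => h (multiplicationThree_iff_at_two.mpr fun s hs =>
    (multiplicationAccessible_iff.mp hA) 2 s (by norm_num) hs)

/-! ### The instance `m = 1` -/

/-- The box domain at `m = 1`, written out. [folklore] -/
theorem boxDom_one : boxDom 1 = {x : Fin 1 → ℝ | x 0 ∈ Set.Ioo (0:ℝ) 1} := by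
  ext x
  simp [boxDom, Fin.forall_fin_one]

/-- The simplex domain at `m = 1`, written out. [folklore] -/
theorem simplexDom_one' : simplexDom 1 = {x : Fin 1 → ℝ | x 0 ∈ Set.Ioo (0:ℝ) 2} := by
  ext x
  simp only [simplexDom, mem_setOf_eq, Fin.forall_fin_one, Fin.sum_univ_one, Nat.cast_one,
    mem_Ioo]
  norm_num

/-- The simplex integrand at `m = 1`, written out. [folklore] -/
theorem simplexFun_one_apply (s : ℚ) (x : Fin 1 → ℝ) :
    simplexFun 1 s x = (x 0 * (2 - x 0)) ^ ((s:ℝ) - 1) := by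
  simp only [simplexFun, Fin.prod_univ_one, Fin.sum_univ_one, Nat.cast_one]
  norm_num

/-- **`DuplicationAllExponents` is the instance `m = 1` of the crux.** [folklore] -/
theorem duplicationAllExponents_iff_at_one :
    DuplicationAllExponents ↔ ∀ s : ℚ, 0 < s → At 1 s := by
  constructor
  · intro h s hs r r' hr hr'
    refine h s hs r r' (hr.1.trans boxDom_one) (fun x hx => ?_) (hr'.1.trans simplexDom_one')
      (fun x hx => ?_)
    · rw [hr.2 hx, boxFun_one_apply]
    · rw [hr'.2 hx, simplexFun_one_apply]
  · intro h s hs r r' hd hi hd' hi'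
    refine h s hs r r' ⟨hd.trans boxDom_one.symm, fun x hx => ?_⟩
      ⟨hd'.trans simplexDom_one'.symm, fun x hx => ?_⟩
    · rw [hi hx, boxFun_one_apply]
    · rw [hi' hx, simplexFun_one_apply]

/-- **A refutation of `DuplicationAllExponents` (support item of the route) refutes the crux**:
the crux at `m = 1` is `DuplicationAllExponents`. [folklore] -/
theorem not_multiplicationAccessible_of_not_duplicationAllExponents (h : ¬ DuplicationAllExponents) :
    ¬ MultiplicationAccessible :=
  fun hA => h (duplicationAllExponents_iff_at_one.mpr fun s hs =>
    (multiplicationAccessible_iff.mp hA) 1 s le_rfl hs)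

/-- **The crux, re-assembled from its named instances**: `MultiplicationAccessible` is exactly
`DuplicationAllExponents ∧ MultiplicationThree ∧ (∀ m ≥ 3, ∀ s > 0, At m s)`. [folklore] -/
theorem multiplicationAccessible_iff_dup_three_rest :
    MultiplicationAccessible ↔ DuplicationAllExponents ∧ MultiplicationThree ∧
      ∀ (m : ℕ) (s : ℚ), 3 ≤ m → 0 < s → At m s := by
  rw [duplicationAllExponents_iff_at_one, multiplicationThree_iff_at_two,
    multiplicationAccessible_iff]
  refine ⟨fun h => ⟨fun s hs => h 1 s le_rfl hs, fun s hs => h 2 s (by norm_num) hs,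
    fun m s hm hs => h m s (by omega) hs⟩, fun ⟨h1, h2, h3⟩ m s hm hs => ?_⟩
  rcases Nat.lt_or_ge m 3 with hlt | hge
  · interval_cases m
    · exact h1 s hs
    · exact h2 s hs
  · exact h3 m s hge hs

end Structure

/-! ## §10 (gen 3) RULE (2) IS NECESSARY: the coordinate-`0` distribution-function invariant of the
change-of-variables-free sub-calculus (1a, 1b, 3), and the `Γ(1/3)³` pair `(2, 1/3)` escaping it
(landed copy: `Theorems/MultiplicationAccessible/Negative/CovFree.lean`) -/

section CovFree

open Literature.ModelTheory.ExponentialFields (IsSemialgebraic)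


variable {n : ℕ}

/-! ## The coordinate-`0` distribution function -/

/-- The window `{z | z 0 ≤ x}` in dimensions `≥ 1`, empty in dimension `0`. [folklore] -/
def cdfWindow (x : ℝ) : (n : ℕ) → Set (Fin n → ℝ)
  | 0 => ∅
  | (_ + 1) => {z | z 0 ≤ x}

/-- The windows are measurable. [folklore] -/
theorem measurableSet_cdfWindow (x : ℝ) : ∀ n, MeasurableSet (cdfWindow x n)
  | 0 => MeasurableSet.empty
  | (_ + 1) => measurableSet_le (measurable_pi_apply 0) measurable_const

/-- **The coordinate-`0` distribution function** of a formal combination of integral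
representations: the generator `[σ, f]` of dimension `≥ 1` is sent to
`x ↦ ∫_{σ ∩ {z 0 ≤ x}} f`, generators of dimension `0` to `0`. [folklore] -/
def cdfEval : FormalRep →+ (ℝ → ℝ) :=
  FreeAbelianGroup.lift fun p => fun x => ∫ z in p.2.domain ∩ cdfWindow x p.1, p.2.integrand z

/-- `cdfEval` on a generator. [folklore] -/
@[simp] theorem cdfEval_of (r : IntegralRep n) :
    cdfEval (of r) = fun x => ∫ z in r.domain ∩ cdfWindow x n, r.integrand z :=
  FreeAbelianGroup.lift_apply_of _ _

/-- At each point, `cdfEval` is the restricted evaluation over the window family `cdfWindow x`.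
[folklore] -/
theorem cdfEval_apply (c : FormalRep) (x : ℝ) : cdfEval c x = restrictedEval (cdfWindow x) c := by
  have h : (Pi.evalAddMonoidHom (fun _ : ℝ => ℝ) x).comp cdfEval = restrictedEval (cdfWindow x) := by
    refine FreeAbelianGroup.lift_ext _ _ fun p => ?_
    obtain ⟨n, r⟩ := p
    change cdfEval (of r) x = restrictedEval (cdfWindow x) (of r)
    rw [cdfEval_of, restrictedEval_of]
  exact DFunLike.congr_fun h c

/-- The additivity moves (1a), (1b) have zero distribution function. [folklore] -/
theorem cdfEval_eq_zero_of_mem_closure_add {c : FormalRep}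
    (hc : c ∈ AddSubgroup.closure (domainAddRel ∪ integrandAddRel)) : cdfEval c = 0 := by
  funext x
  rw [cdfEval_apply]
  exact closure_add_le_ker_restrictedEval (cdfWindow x) (measurableSet_cdfWindow x) hc

/-! ## Newton–Leibniz moves between positive dimensions preserve the distribution function -/

/-- **Restricted soundness of the Newton–Leibniz move.** For the data of a Newton–Leibniz move
`[r] − [r']` (band `r.domain` over the base `r'.domain`, primitive `F` along the last coordinate)
and ANY measurable base window `A`, the integral of `r` over the part of the band above
`r'.domain ∩ A` equals the integral of `r'` over `r'.domain ∩ A` (Fubini + the fundamental theorem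
of calculus fibrewise; the soundness computation of `KZ.eval_eq_zero_of_mem_newtonLeibnizRel_holds`
localised to `A`). [cite: KontsevichZagier2001, §1.2 rule (3)] -/
theorem setIntegral_band_inter_eq {n : ℕ} (r : IntegralRep (n + 1)) (r' : IntegralRep n)
    (a b : (Fin n → ℝ) → ℝ) (F : (Fin (n + 1) → ℝ) → ℝ)
    (hab : ∀ x ∈ r'.domain, a x ≤ b x)
    (hdom : r.domain = {z | (Fin.init z : Fin n → ℝ) ∈ r'.domain ∧ a (Fin.init z) ≤ z (Fin.last n) ∧
      z (Fin.last n) ≤ b (Fin.init z)})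
    (hcont : ∀ x ∈ r'.domain, ContinuousOn (fun t : ℝ => F (Fin.snoc x t)) (Icc (a x) (b x)))
    (hderiv : ∀ x ∈ r'.domain, ∀ t ∈ Ioo (a x) (b x),
      HasDerivAt (fun s : ℝ => F (Fin.snoc x s)) (r.integrand (Fin.snoc x t)) t)
    (hr' : ∀ x ∈ r'.domain, r'.integrand x = F (Fin.snoc x (b x)) - F (Fin.snoc x (a x)))
    {A : Set (Fin n → ℝ)} (hA : MeasurableSet A) :
    ∫ z in r.domain ∩ {z | Fin.init z ∈ A}, r.integrand z = ∫ x in r'.domain ∩ A, r'.integrand x := by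
  have hτm : MeasurableSet r'.domain := IntegralRep.measurableSet_domain_holds r'
  have hbm : MeasurableSet r.domain := IntegralRep.measurableSet_domain_holds r
  have hAm : MeasurableSet {z : Fin (n + 1) → ℝ | Fin.init z ∈ A} := by
    have : Measurable (fun z : Fin (n + 1) → ℝ => (Fin.init z : Fin n → ℝ)) :=
      measurable_pi_lambda _ fun i => measurable_pi_apply _
    exact this hA
  set τ' : Set (Fin n → ℝ) := r'.domain ∩ A with hτ'
  have hτ'm : MeasurableSet τ' := hτm.inter hA
  set B' : Set (Fin (n + 1) → ℝ) := r.domain ∩ {z | Fin.init z ∈ A} with hB'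
  have hB'm : MeasurableSet B' := hbm.inter hAm
  -- split off the last coordinate
  set e : (Fin (n + 1) → ℝ) ≃ᵐ ℝ × (Fin n → ℝ) :=
    MeasurableEquiv.piFinSuccAbove (fun _ => ℝ) (Fin.last n) with he_def
  have he : MeasurePreserving e volume volume :=
    volume_preserving_piFinSuccAbove (fun _ => ℝ) (Fin.last n)
  have he_symm : ∀ p : ℝ × (Fin n → ℝ), e.symm p = Fin.snoc p.2 p.1 := fun p => by
    simp [he_def, MeasurableEquiv.piFinSuccAbove, Fin.snocEquiv]
  have hmem : ∀ x t, Fin.snoc x t ∈ B' ↔ x ∈ τ' ∧ t ∈ Icc (a x) (b x) := by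
    intro x t
    rw [hB', hdom, hτ']
    simp only [mem_inter_iff, mem_setOf_eq, Fin.init_snoc, Fin.snoc_last, mem_Icc]
    tauto
  set G : (Fin (n + 1) → ℝ) → ℝ := B'.indicator r.integrand with hG_def
  have hG : Integrable G :=
    (integrable_indicator_iff hB'm).mpr (r.integrableOn.mono_set inter_subset_left)
  have hfib_in : ∀ x ∈ τ', (fun t => G (Fin.snoc x t)) =
      (Icc (a x) (b x)).indicator (fun t => r.integrand (Fin.snoc x t)) := by
    intro x hx
    ext t
    by_cases ht : t ∈ Icc (a x) (b x)
    · rw [Set.indicator_of_mem ht, hG_def, Set.indicator_of_mem ((hmem x t).2 ⟨hx, ht⟩)]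
    · rw [Set.indicator_of_notMem ht, hG_def,
        Set.indicator_of_notMem (fun h => ht ((hmem x t).1 h).2)]
  have hfib_out : ∀ x ∉ τ', (fun t => G (Fin.snoc x t)) = fun _ => 0 := by
    intro x hx
    ext t
    rw [hG_def, Set.indicator_of_notMem (fun h => hx ((hmem x t).1 h).1)]
  have hG2 : Integrable (fun p : ℝ × (Fin n → ℝ) => G (Fin.snoc p.2 p.1))
      ((volume : Measure ℝ).prod (volume : Measure (Fin n → ℝ))) := by
    have h := ((he.symm e).integrable_comp_emb e.symm.measurableEmbedding (g := G)).mpr hG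
    rw [← Measure.volume_eq_prod]
    convert h using 1
    ext p
    simp [he_symm]
  calc ∫ z in B', r.integrand z
      = ∫ z, G z := (integral_indicator hB'm).symm
    _ = ∫ p, G (e.symm p) := ((he.symm e).integral_comp' G).symm
    _ = ∫ p : ℝ × (Fin n → ℝ), G (Fin.snoc p.2 p.1) ∂(volume.prod volume) := by
        simp_rw [he_symm, Measure.volume_eq_prod]
    _ = ∫ x, ∫ t, G (Fin.snoc x t) := integral_prod_symm _ hG2
    _ = ∫ x, τ'.indicator (fun x => F (Fin.snoc x (b x)) - F (Fin.snoc x (a x))) x := by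
        apply integral_congr_ae
        filter_upwards [hG2.prod_left_ae] with x hx
        by_cases hxτ : x ∈ τ'
        · have hxτ0 : x ∈ r'.domain := hxτ.1
          rw [Set.indicator_of_mem hxτ, hfib_in x hxτ, integral_indicator measurableSet_Icc,
            integral_Icc_eq_integral_Ioc, ← intervalIntegral.integral_of_le (hab x hxτ0)]
          apply intervalIntegral.integral_eq_sub_of_hasDerivAt_of_le (hab x hxτ0) (hcont x hxτ0)
            (hderiv x hxτ0)
          rw [intervalIntegrable_iff_integrableOn_Icc_of_le (hab x hxτ0)]
          have hx' : Integrable (fun t => G (Fin.snoc x t)) := hx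
          rw [hfib_in x hxτ] at hx'
          exact (integrable_indicator_iff measurableSet_Icc).mp hx'
        · rw [Set.indicator_of_notMem hxτ]
          rw [hfib_out x hxτ, integral_zero]
    _ = ∫ x in τ', (F (Fin.snoc x (b x)) - F (Fin.snoc x (a x))) := integral_indicator hτ'm
    _ = ∫ x in τ', r'.integrand x :=
        (setIntegral_congr_fun hτ'm fun x hx => hr' x hx.1).symm

/-- A Newton–Leibniz move between POSITIVE dimensions `k + 2 → k + 1` has zero coordinate-`0`
distribution function: the window `{z 0 ≤ x}` is a cylinder over the base window `{y 0 ≤ x}`.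
[cite: KontsevichZagier2001, §1.2 rule (3)] -/
theorem cdfEval_nl_succ {k : ℕ} (r : IntegralRep (k + 1 + 1)) (r' : IntegralRep (k + 1))
    (a b : (Fin (k + 1) → ℝ) → ℝ) (F : (Fin (k + 1 + 1) → ℝ) → ℝ)
    (hab : ∀ x ∈ r'.domain, a x ≤ b x)
    (hdom : r.domain = {z | (Fin.init z : Fin (k + 1) → ℝ) ∈ r'.domain ∧
      a (Fin.init z) ≤ z (Fin.last (k + 1)) ∧ z (Fin.last (k + 1)) ≤ b (Fin.init z)})
    (hcont : ∀ x ∈ r'.domain, ContinuousOn (fun t : ℝ => F (Fin.snoc x t)) (Icc (a x) (b x)))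
    (hderiv : ∀ x ∈ r'.domain, ∀ t ∈ Ioo (a x) (b x),
      HasDerivAt (fun s : ℝ => F (Fin.snoc x s)) (r.integrand (Fin.snoc x t)) t)
    (hr' : ∀ x ∈ r'.domain, r'.integrand x = F (Fin.snoc x (b x)) - F (Fin.snoc x (a x))) :
    cdfEval (of r - of r') = 0 := by
  funext x
  rw [map_sub, cdfEval_of, cdfEval_of]
  simp only [Pi.sub_apply, Pi.zero_apply, sub_eq_zero]
  have hwin : cdfWindow x (k + 1 + 1) = {z : Fin (k + 1 + 1) → ℝ | Fin.init z ∈ cdfWindow x (k + 1)} := by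
    ext z
    simp only [cdfWindow, mem_setOf_eq]
    rw [Fin.init_def]
    rfl
  rw [hwin]
  exact setIntegral_band_inter_eq r r' a b F hab hdom hcont hderiv hr' (measurableSet_cdfWindow x _)


/-! ## The class of piecewise (constant + continuous `ℚ`-semialgebraic) functions -/

/-- The rational open interval `(q₁, q₂)` as a subset of `ℝ¹`. [folklore] -/
def ivl (q₁ q₂ : ℚ) : Set (Fin 1 → ℝ) := {z | z 0 ∈ Ioo (q₁:ℝ) q₂}

open MvPolynomial in
/-- Rational intervals are `ℚ`-semialgebraic. [folklore] -/
theorem isSemialgebraic_ivl (q₁ q₂ : ℚ) : IsSemialgebraic ℚ (ivl q₁ q₂) := by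
  have h1 := Literature.ModelTheory.ExponentialFields.isSemialgebraic_setOf_eval_pos (k := ℚ)
    (R := ℝ) (X 0 - C q₁ : MvPolynomial (Fin 1) ℚ)
  have h2 := Literature.ModelTheory.ExponentialFields.isSemialgebraic_setOf_eval_pos (k := ℚ)
    (R := ℝ) (C q₂ - X 0 : MvPolynomial (Fin 1) ℚ)
  simp only [map_sub, MvPolynomial.aeval_X, MvPolynomial.aeval_C, eq_ratCast, sub_pos] at h1 h2
  convert h1.inter h2 using 1
  ext x
  simp [ivl]

open MvPolynomial in
/-- The zero function is `ℚ`-semialgebraic on a rational interval. [folklore] -/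
theorem isSemialgebraicFunOn_zero_ivl (q₁ q₂ : ℚ) :
    IsSemialgebraicFunOn ℚ (ivl q₁ q₂) (fun _ => (0:ℝ)) :=
  (isSemialgebraicFunOn_aeval (isSemialgebraic_ivl q₁ q₂) (0 : MvPolynomial (Fin 1) ℚ)).congr
    fun z _ => by simp

/-- **Piecewise (constant + continuous `ℚ`-semialgebraic).** `φ : ℝ → ℝ` is, off a finite set of
points, locally (on a rational interval around each point) a real constant plus a continuous
`ℚ`-semialgebraic function of one variable. The real constant absorbs transcendental values
(periods); the `ℚ`-semialgebraic part is what a Newton–Leibniz primitive can contribute. [folklore] -/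
def IsPiecewise (φ : ℝ → ℝ) : Prop :=
  ∃ S : Finset ℝ, ∀ x : ℝ, x ∉ S → ∃ (q₁ q₂ : ℚ), (q₁:ℝ) < x ∧ x < (q₂:ℝ) ∧
    ∃ (c : ℝ) (g : (Fin 1 → ℝ) → ℝ), IsSemialgebraicFunOn ℚ (ivl q₁ q₂) g ∧
      ContinuousOn (fun t : ℝ => g (fun _ => t)) (Ioo (q₁:ℝ) q₂) ∧
      ∀ t ∈ Ioo (q₁:ℝ) q₂, φ t = c + g (fun _ => t)

/-- Rationals on both sides of a real number. [folklore] -/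
theorem exists_rat_lt_lt (x : ℝ) : ∃ q₁ q₂ : ℚ, (q₁:ℝ) < x ∧ x < q₂ := by
  obtain ⟨q₁, -, h₁⟩ := exists_rat_btwn (show x - 1 < x by linarith)
  obtain ⟨q₂, h₂, -⟩ := exists_rat_btwn (show x < x + 1 by linarith)
  exact ⟨q₁, q₂, h₁, h₂⟩

/-- A function which is locally constant off a finite set is piecewise. [folklore] -/
theorem isPiecewise_of_locallyConst {φ : ℝ → ℝ} (S : Finset ℝ)
    (h : ∀ x, x ∉ S → ∃ (q₁ q₂ : ℚ), (q₁:ℝ) < x ∧ x < (q₂:ℝ) ∧ ∃ c : ℝ,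
      ∀ t ∈ Ioo (q₁:ℝ) q₂, φ t = c) : IsPiecewise φ := by
  refine ⟨S, fun x hx => ?_⟩
  obtain ⟨q₁, q₂, h₁, h₂, c, hc⟩ := h x hx
  exact ⟨q₁, q₂, h₁, h₂, c, fun _ => 0, isSemialgebraicFunOn_zero_ivl q₁ q₂, continuousOn_const,
    fun t ht => by rw [hc t ht, add_zero]⟩

/-- The zero function is piecewise. [folklore] -/
theorem isPiecewise_zero : IsPiecewise (0 : ℝ → ℝ) :=
  isPiecewise_of_locallyConst ∅ fun x _ => by
    obtain ⟨q₁, q₂, h₁, h₂⟩ := exists_rat_lt_lt x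
    exact ⟨q₁, q₂, h₁, h₂, 0, fun t _ => rfl⟩

/-- Piecewise functions are stable under addition (sum of `ℚ`-semialgebraic functions:
Tarski–Seidenberg, `IsSemialgebraicFunOn.add_holds`). [folklore] -/
theorem IsPiecewise.add {φ ψ : ℝ → ℝ} (hφ : IsPiecewise φ) (hψ : IsPiecewise ψ) :
    IsPiecewise (φ + ψ) := by
  classical
  obtain ⟨S₁, h₁⟩ := hφ
  obtain ⟨S₂, h₂⟩ := hψ
  refine ⟨S₁ ∪ S₂, fun x hx => ?_⟩
  rw [Finset.mem_union, not_or] at hx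
  obtain ⟨q₁, q₂, hq₁, hq₂, c, g, hg, hgc, hφg⟩ := h₁ x hx.1
  obtain ⟨q₁', q₂', hq₁', hq₂', c', g', hg', hgc', hψg⟩ := h₂ x hx.2
  have hsub : ivl (max q₁ q₁') (min q₂ q₂') ⊆ ivl q₁ q₂ := fun z hz => by
    simp only [ivl, mem_setOf_eq, mem_Ioo, Rat.cast_max, Rat.cast_min] at hz ⊢
    exact ⟨(le_max_left _ _).trans_lt hz.1, hz.2.trans_le (min_le_left _ _)⟩
  have hsub' : ivl (max q₁ q₁') (min q₂ q₂') ⊆ ivl q₁' q₂' := fun z hz => by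
    simp only [ivl, mem_setOf_eq, mem_Ioo, Rat.cast_max, Rat.cast_min] at hz ⊢
    exact ⟨(le_max_right _ _).trans_lt hz.1, hz.2.trans_le (min_le_right _ _)⟩
  have hI : Ioo ((max q₁ q₁' : ℚ):ℝ) ((min q₂ q₂' : ℚ):ℝ) ⊆ Ioo (q₁:ℝ) q₂ := fun t ht => by
    simp only [mem_Ioo, Rat.cast_max, Rat.cast_min] at ht ⊢
    exact ⟨(le_max_left _ _).trans_lt ht.1, ht.2.trans_le (min_le_left _ _)⟩
  have hI' : Ioo ((max q₁ q₁' : ℚ):ℝ) ((min q₂ q₂' : ℚ):ℝ) ⊆ Ioo (q₁':ℝ) q₂' := fun t ht => by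
    simp only [mem_Ioo, Rat.cast_max, Rat.cast_min] at ht ⊢
    exact ⟨(le_max_right _ _).trans_lt ht.1, ht.2.trans_le (min_le_right _ _)⟩
  refine ⟨max q₁ q₁', min q₂ q₂', ?_, ?_, c + c', g + g', ?_, ?_, fun t ht => ?_⟩
  · rw [Rat.cast_max]; exact max_lt hq₁ hq₁'
  · rw [Rat.cast_min]; exact lt_min hq₂ hq₂'
  · exact IsSemialgebraicFunOn.add_holds (hg.mono hsub (isSemialgebraic_ivl _ _))
      (hg'.mono hsub' (isSemialgebraic_ivl _ _))
  · exact (hgc.mono hI).add (hgc'.mono hI')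
  · rw [Pi.add_apply, hφg t (hI ht), hψg t (hI' ht), Pi.add_apply]
    ring

/-- Piecewise functions are stable under negation. [folklore] -/
theorem IsPiecewise.neg {φ : ℝ → ℝ} (hφ : IsPiecewise φ) : IsPiecewise (-φ) := by
  obtain ⟨S, h⟩ := hφ
  refine ⟨S, fun x hx => ?_⟩
  obtain ⟨q₁, q₂, hq₁, hq₂, c, g, hg, hgc, hφg⟩ := h x hx
  refine ⟨q₁, q₂, hq₁, hq₂, -c, -g, hg.neg, hgc.neg, fun t ht => ?_⟩
  rw [Pi.neg_apply, hφg t ht, Pi.neg_apply]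
  ring

/-- **The subgroup of piecewise (constant + continuous `ℚ`-semialgebraic) functions.** [folklore] -/
def piecewiseSemialg : AddSubgroup (ℝ → ℝ) where
  carrier := {φ | IsPiecewise φ}
  add_mem' := IsPiecewise.add
  zero_mem' := isPiecewise_zero
  neg_mem' := IsPiecewise.neg

/-- Membership in `piecewiseSemialg`. [folklore] -/
@[simp] theorem mem_piecewiseSemialg {φ : ℝ → ℝ} : φ ∈ piecewiseSemialg ↔ IsPiecewise φ := Iff.rfl

/-! ## Newton–Leibniz moves `1 → 0`: the primitive enters, and it is `ℚ`-semialgebraic -/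

/-- One-variable integrals over subsets of `ℝ¹` are integrals over `ℝ`. [folklore] -/
theorem setIntegral_fin_one (I : Set ℝ) (f : (Fin 1 → ℝ) → ℝ) :
    ∫ z in {z : Fin 1 → ℝ | z 0 ∈ I}, f z = ∫ t in I, f (fun _ => t) := by
  have hset : {z : Fin 1 → ℝ | z 0 ∈ I} = MeasurableEquiv.funUnique (Fin 1) ℝ ⁻¹' I := by
    ext z; simp only [mem_setOf_eq, mem_preimage, funUnique_apply]
  have hfun : ∀ z : Fin 1 → ℝ, f z = (fun t : ℝ => f (fun _ => t)) (MeasurableEquiv.funUnique (Fin 1) ℝ z) := by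
    intro z
    rw [funUnique_apply]
    congr 1
    funext i
    rw [Subsingleton.elim i 0]
  rw [hset]
  have h1 : ∫ z in ⇑(MeasurableEquiv.funUnique (Fin 1) ℝ) ⁻¹' I, f z =
      ∫ z in ⇑(MeasurableEquiv.funUnique (Fin 1) ℝ) ⁻¹' I,
        (fun t : ℝ => f (fun _ => t)) (MeasurableEquiv.funUnique (Fin 1) ℝ z) :=
    integral_congr_ae (ae_of_all _ hfun)
  rw [h1]
  exact (volume_preserving_funUnique (Fin 1) ℝ).setIntegral_preimage_emb
    (MeasurableEquiv.measurableEmbedding _) (fun t : ℝ => f (fun _ => t)) I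

/-- One-variable integrability over subsets of `ℝ¹`. [folklore] -/
theorem integrableOn_fin_one_iff (I : Set ℝ) (f : (Fin 1 → ℝ) → ℝ) :
    IntegrableOn f {z : Fin 1 → ℝ | z 0 ∈ I} ↔ IntegrableOn (fun t : ℝ => f (fun _ => t)) I := by
  have hset : {z : Fin 1 → ℝ | z 0 ∈ I} = MeasurableEquiv.funUnique (Fin 1) ℝ ⁻¹' I := by
    ext z; simp only [mem_setOf_eq, mem_preimage, funUnique_apply]
  have hfun : f = (fun t : ℝ => f (fun _ => t)) ∘ (MeasurableEquiv.funUnique (Fin 1) ℝ) := by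
    funext z
    rw [Function.comp_apply, funUnique_apply]
    congr 1
    funext i
    rw [Subsingleton.elim i 0]
  rw [hset]
  conv_lhs => rw [hfun]
  exact (volume_preserving_funUnique (Fin 1) ℝ).integrableOn_comp_preimage
    (MeasurableEquiv.measurableEmbedding _)

/-- **A Newton–Leibniz move `1 → 0` has a piecewise distribution function**: for the band
`[a, b] ⊆ ℝ¹` over the one-point base with `ℚ`-semialgebraic primitive `F` (continuous on
`[a, b]`, `F' = f` on `(a, b)`), `x ↦ ∫_{[a,b] ∩ (−∞, x]} f` is `0` left of `a`, `F(x) − F(a)` on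
`(a, b)` and `F(b) − F(a)` right of `b` — locally a real constant plus the continuous
`ℚ`-semialgebraic `F`, off `{a, b}`. This is the only place where a move feeds a function into the
invariant, and that function is a PRIMITIVE ADMITTED BY RULE (3). [cite: KontsevichZagier2001, §1.2 rule (3)] -/
theorem isPiecewise_nl_zero (r : IntegralRep 1) (r' : IntegralRep 0)
    (a b : (Fin 0 → ℝ) → ℝ) (F : (Fin 1 → ℝ) → ℝ)
    (hF : IsSemialgebraicFunOn ℚ r.domain F)
    (hab : ∀ x ∈ r'.domain, a x ≤ b x)
    (hdom : r.domain = {z | (Fin.init z : Fin 0 → ℝ) ∈ r'.domain ∧ a (Fin.init z) ≤ z (Fin.last 0) ∧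
      z (Fin.last 0) ≤ b (Fin.init z)})
    (hcont : ∀ x ∈ r'.domain, ContinuousOn (fun t : ℝ => F (Fin.snoc x t)) (Icc (a x) (b x)))
    (hderiv : ∀ x ∈ r'.domain, ∀ t ∈ Ioo (a x) (b x),
      HasDerivAt (fun s : ℝ => F (Fin.snoc x s)) (r.integrand (Fin.snoc x t)) t) :
    IsPiecewise (cdfEval (of r - of r')) := by
  -- the distribution function is a one-variable integral
  set f₁ : ℝ → ℝ := fun t => r.integrand (fun _ => t) with hf₁
  set F₁ : ℝ → ℝ := fun t => F (fun _ => t) with hF₁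
  set e₀ : Fin 0 → ℝ := fun i => i.elim0 with he₀
  have hinit : ∀ z : Fin 1 → ℝ, (Fin.init z : Fin 0 → ℝ) = e₀ := fun z => Subsingleton.elim _ _
  have hsnoc : ∀ t : ℝ, (Fin.snoc e₀ t : Fin 1 → ℝ) = fun _ => t := by
    intro t
    funext i
    have hi : i = Fin.last 0 := Fin.ext (by rw [Fin.val_last]; exact Fin.val_eq_zero i)
    rw [hi, Fin.snoc_last]
  have hval : ∀ x, cdfEval (of r - of r') x = ∫ z in r.domain ∩ {z | z 0 ≤ x}, r.integrand z := by
    intro x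
    rw [map_sub]
    simp only [cdfEval_of, Pi.sub_apply]
    have h0 : r'.domain ∩ cdfWindow x 0 = ∅ := by simp [cdfWindow]
    rw [h0, Measure.restrict_empty, integral_zero_measure, sub_zero]
    rfl
  by_cases he : e₀ ∈ r'.domain
  swap
  · -- empty band: the distribution function vanishes identically
    have hempty : r.domain = ∅ := by
      rw [hdom]
      ext z
      simp only [mem_setOf_eq, mem_empty_iff_false, iff_false, not_and]
      intro hz
      exact absurd (hinit z ▸ hz) he
    refine isPiecewise_of_locallyConst ∅ fun x _ => ?_
    obtain ⟨q₁, q₂, h₁, h₂⟩ := exists_rat_lt_lt x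
    refine ⟨q₁, q₂, h₁, h₂, 0, fun t _ => ?_⟩
    rw [hval, hempty, Set.empty_inter, Measure.restrict_empty, integral_zero_measure]
  -- the band `[α, β]`
  set α : ℝ := a e₀ with hα
  set β : ℝ := b e₀ with hβ
  have hαβ : α ≤ β := hab e₀ he
  have hdom' : r.domain = {z | z 0 ∈ Icc α β} := by
    rw [hdom]
    ext z
    simp only [mem_setOf_eq, hinit z, mem_Icc]
    exact ⟨fun h => ⟨h.2.1, h.2.2⟩, fun h => ⟨he, h.1, h.2⟩⟩
  have hΦ : ∀ x, cdfEval (of r - of r') x = ∫ t in Icc α β ∩ Iic x, f₁ t := by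
    intro x
    have hset : r.domain ∩ {z | z 0 ≤ x} = {z : Fin 1 → ℝ | z 0 ∈ Icc α β ∩ Iic x} := by
      rw [hdom']
      ext z
      simp only [mem_inter_iff, mem_setOf_eq, mem_Iic]
    rw [hval, hset, setIntegral_fin_one]
  have hint : IntegrableOn f₁ (Icc α β) := by
    have := r.integrableOn
    rw [hdom', integrableOn_fin_one_iff] at this
    exact this
  have hcont' : ContinuousOn F₁ (Icc α β) := by
    have h := hcont e₀ he
    simp only [hsnoc] at h
    exact h
  have hderiv' : ∀ t ∈ Ioo α β, HasDerivAt F₁ (f₁ t) t := by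
    intro t ht
    have h := hderiv e₀ he t ht
    simp only [hsnoc] at h
    exact h
  -- the three regimes
  have hleft : ∀ x, x < α → ∫ t in Icc α β ∩ Iic x, f₁ t = 0 := by
    intro x hx
    have : Icc α β ∩ Iic x = ∅ := by
      ext t
      simp only [mem_inter_iff, mem_Icc, mem_Iic, mem_empty_iff_false, iff_false, not_and, and_imp]
      intro h1 _ h3
      linarith
    rw [this, Measure.restrict_empty, integral_zero_measure]
  have hmid : ∀ x, α ≤ x → x ≤ β → ∫ t in Icc α β ∩ Iic x, f₁ t = F₁ x - F₁ α := by
    intro x hαx hxβ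
    have hset : Icc α β ∩ Iic x = Icc α x := by
      ext t
      simp only [mem_inter_iff, mem_Icc, mem_Iic]
      constructor
      · rintro ⟨⟨h1, _⟩, h3⟩; exact ⟨h1, h3⟩
      · rintro ⟨h1, h2⟩; exact ⟨⟨h1, h2.trans hxβ⟩, h2⟩
    rw [hset, integral_Icc_eq_integral_Ioc, ← intervalIntegral.integral_of_le hαx]
    refine intervalIntegral.integral_eq_sub_of_hasDerivAt_of_le hαx
      (hcont'.mono (Icc_subset_Icc_right hxβ))
      (fun t ht => hderiv' t ⟨ht.1, ht.2.trans_le hxβ⟩) ?_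
    exact (intervalIntegrable_iff_integrableOn_Icc_of_le hαx).mpr
      (hint.mono_set (Icc_subset_Icc_right hxβ))
  have hright : ∀ x, β ≤ x → ∫ t in Icc α β ∩ Iic x, f₁ t = ∫ t in Icc α β, f₁ t := by
    intro x hx
    have : Icc α β ∩ Iic x = Icc α β := by
      ext t
      simp only [mem_inter_iff, mem_Icc, mem_Iic, and_iff_left_iff_imp, and_imp]
      intro _ h2
      exact h2.trans hx
    rw [this]
  -- assemble
  refine ⟨{α, β}, fun x hx => ?_⟩
  simp only [Finset.mem_insert, Finset.mem_singleton, not_or] at hx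
  rcases lt_or_gt_of_ne hx.1 with hxa | hxa
  · -- left of the band: identically zero
    obtain ⟨q₁, -, h₁⟩ := exists_rat_btwn (show x - 1 < x by linarith)
    obtain ⟨q₂, h₂, h₂'⟩ := exists_rat_btwn hxa
    refine ⟨q₁, q₂, h₁, h₂, 0, fun _ => 0, isSemialgebraicFunOn_zero_ivl q₁ q₂, continuousOn_const,
      fun t ht => ?_⟩
    rw [hΦ, hleft t (ht.2.trans h₂'), add_zero]
  rcases lt_or_gt_of_ne hx.2 with hxb | hxb
  · -- inside the band: `F(x) − F(α)`
    obtain ⟨q₁, h₁', h₁⟩ := exists_rat_btwn hxa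
    obtain ⟨q₂, h₂, h₂'⟩ := exists_rat_btwn hxb
    have hsub : ivl q₁ q₂ ⊆ r.domain := fun z hz => by
      rw [hdom']
      simp only [ivl, mem_setOf_eq, mem_Ioo] at hz
      exact ⟨(h₁'.trans hz.1).le, (hz.2.trans h₂').le⟩
    refine ⟨q₁, q₂, h₁, h₂, -F₁ α, F, hF.mono hsub (isSemialgebraic_ivl q₁ q₂), ?_, fun t ht => ?_⟩
    · exact hcont'.mono fun t ht => ⟨(h₁'.trans ht.1).le, (ht.2.trans h₂').le⟩
    · rw [hΦ, hmid t (h₁'.trans ht.1).le (ht.2.trans h₂').le]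
      simp only [hF₁]
      ring
  · -- right of the band: the constant `∫_{[α,β]} f`
    obtain ⟨q₁, h₁', h₁⟩ := exists_rat_btwn hxb
    obtain ⟨q₂, h₂, -⟩ := exists_rat_btwn (show x < x + 1 by linarith)
    refine ⟨q₁, q₂, h₁, h₂, ∫ t in Icc α β, f₁ t, fun _ => 0, isSemialgebraicFunOn_zero_ivl q₁ q₂,
      continuousOn_const, fun t ht => ?_⟩
    rw [hΦ, hright t (h₁'.trans ht.1).le, add_zero]

/-! ## The sub-calculus theorem -/

/-- **Rules (1a), (1b), (3) act inside the piecewise class.** Every element of the subgroup of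
`FormalRep` generated by domain additivity, integrand additivity and Newton–Leibniz moves (in all
dimensions, no change of variables) has a coordinate-`0` distribution function which is piecewise
(real constant + continuous `ℚ`-semialgebraic). Consequently a pair of representations whose
distribution functions differ by a function outside this class needs a change of variables
(rule 2) in every derivation. [cite: KontsevichZagier2001, §1.2] -/
theorem closure_add_nl_le_comap_cdfEval :
    AddSubgroup.closure (domainAddRel ∪ integrandAddRel ∪ newtonLeibnizRel) ≤
      piecewiseSemialg.comap cdfEval := by
  refine (AddSubgroup.closure_le _).mpr ?_
  rintro c ((hc | hc) | hc)
  · show IsPiecewise (cdfEval c)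
    rw [cdfEval_eq_zero_of_mem_closure_add (AddSubgroup.subset_closure (Or.inl hc))]
    exact isPiecewise_zero
  · show IsPiecewise (cdfEval c)
    rw [cdfEval_eq_zero_of_mem_closure_add (AddSubgroup.subset_closure (Or.inr hc))]
    exact isPiecewise_zero
  · obtain ⟨n, r, r', a, b, F, hF, -, -, hab, hdom, hcont, hderiv, hr', rfl⟩ := hc
    show IsPiecewise (cdfEval (of r - of r'))
    cases n with
    | zero => exact isPiecewise_nl_zero r r' a b F hF hab hdom hcont hderiv
    | succ k =>
      rw [cdfEval_nl_succ r r' a b F hab hdom hcont hderiv hr']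
      exact isPiecewise_zero

/-- **Corollary (the obstruction in usable form).** If `[r] − [r']` is derivable by rules
(1a), (1b), (3) alone, then `cdfEval (of r) − cdfEval (of r')` is piecewise
(constant + continuous `ℚ`-semialgebraic). [cite: KontsevichZagier2001, §1.2] -/
theorem isPiecewise_of_mem_closure_add_nl {n m : ℕ} {r : IntegralRep n} {r' : IntegralRep m}
    (h : of r - of r' ∈ AddSubgroup.closure (domainAddRel ∪ integrandAddRel ∪ newtonLeibnizRel)) :
    IsPiecewise (cdfEval (of r) - cdfEval (of r')) := by
  have := closure_add_nl_le_comap_cdfEval h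
  rwa [AddSubgroup.mem_comap, map_sub, mem_piecewiseSemialg] at this


open Real
open Summit.KontsevichZagierPeriods.TerasomaMultiplication.MultiplicationThreeNegative
  hiding boxFun simplexFun


/-- The dimension-2 box integrand of `MultiplicationThree/Negative/Pinned.lean`. -/
local notation "boxFun₃" =>
  Summit.KontsevichZagierPeriods.TerasomaMultiplication.MultiplicationThreeNegative.boxFun
/-- The dimension-2 simplex integrand of `MultiplicationThree/Negative/Pinned.lean`. -/
local notation "simplexFun₃" =>
  Summit.KontsevichZagierPeriods.TerasomaMultiplication.MultiplicationThreeNegative.simplexFun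

/-! ## The windowed chart: coordinate-`0` distribution function of the simplex side -/

/-- The windowed box `(0,1)² ∩ {u ≤ y}` as a product set. [folklore] -/
def wbox (y : ℝ) : Fin 2 → Set ℝ := ![Ioo 0 1 ∩ Iic y, Ioo 0 1]

/-- The windowed box is the product of its factors. [folklore] -/
theorem box_inter_eq_pi (y : ℝ) :
    box ∩ {u : Fin 2 → ℝ | u 0 ≤ y} = Set.pi Set.univ (wbox y) := by
  ext u
  simp only [box, mem_inter_iff, mem_setOf_eq, mem_pi, mem_univ, true_implies, Fin.forall_fin_two,
    wbox, Matrix.cons_val_zero, Matrix.cons_val_one, mem_Iic]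
  tauto

/-- Lebesgue measure restricted to the windowed box is a product measure. [folklore] -/
theorem volume_restrict_box_inter (y : ℝ) :
    (volume : Measure (Fin 2 → ℝ)).restrict (box ∩ {u : Fin 2 → ℝ | u 0 ≤ y}) =
      Measure.pi fun i : Fin 2 => (volume : Measure ℝ).restrict (wbox y i) := by
  rw [box_inter_eq_pi, volume_pi, Measure.restrict_pi_pi]

/-- The chart `Φ(u, v) = (3u, 3(1−u)v)` carries the windowed box onto the windowed triangle
(its first component is `3u`). [folklore] -/
theorem image_Φ_box_inter (y : ℝ) :
    Φ '' (box ∩ {u : Fin 2 → ℝ | u 0 ≤ y}) = triangle ∩ {z : Fin 2 → ℝ | z 0 ≤ 3 * y} := by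
  ext z
  constructor
  · rintro ⟨u, ⟨hu, huy⟩, rfl⟩
    refine ⟨?_, ?_⟩
    · rw [← image_Φ_box]; exact ⟨u, hu, rfl⟩
    · show Φ u 0 ≤ 3 * y
      rw [Φ_apply_zero]
      have : u 0 ≤ y := huy
      linarith
  · rintro ⟨hz, hzy⟩
    rw [← image_Φ_box] at hz
    obtain ⟨u, hu, rfl⟩ := hz
    refine ⟨u, ⟨hu, ?_⟩, rfl⟩
    show u 0 ≤ y
    have : Φ u 0 ≤ 3 * y := hzy
    rw [Φ_apply_zero] at this
    linarith

/-- Measurability of the windowed box. [folklore] -/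
theorem measurableSet_box_inter (y : ℝ) : MeasurableSet (box ∩ {u : Fin 2 → ℝ | u 0 ≤ y}) :=
  measurableSet_box.inter (measurableSet_le (measurable_pi_apply 0) measurable_const)

/-- **The coordinate-`0` distribution function of the simplex representation**, for every real
`x`: `∫_{triangle ∩ {σ₁ ≤ x}} (σ₁σ₂(3−σ₁−σ₂))^{s−1}
= 9·27^{s−1} · (∫_{(0,1) ∩ (−∞, x/3]} u^{s−1}(1−u)^{2s−1} du) · (∫₀¹ (v(1−v))^{s−1} dv)`
(windowed chart + Fubini on the product). [folklore] -/
theorem cdfEval_simplexRep {s : ℚ} (hs : 0 < s) (x : ℝ) :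
    cdfEval (of (simplexRep s hs)) x =
      pullConst s * ((∫ u in Ioo (0:ℝ) 1 ∩ Iic (x / 3), pullFactor s 0 u) *
        (∫ v in Ioo (0:ℝ) 1, pullFactor s 1 v)) := by
  rw [cdfEval_of]
  change ∫ z in triangle ∩ {z : Fin 2 → ℝ | z 0 ≤ x}, simplexFun₃ s z = _
  have hx : x = 3 * (x / 3) := by ring
  conv_lhs => rw [hx]
  rw [← image_Φ_box_inter, integral_image_eq_integral_abs_det_fderiv_smul volume
    (measurableSet_box_inter _) (fun u _ => (hasFDerivAt_Φ u).hasFDerivWithinAt)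
    (injOn_Φ.mono inter_subset_left)]
  rw [setIntegral_congr_fun (measurableSet_box_inter _)
      (fun u hu => by rw [smul_eq_mul, pullback_eq hu.1]),
    integral_const_mul, volume_restrict_box_inter,
    integral_fintype_prod_eq_prod (𝕜 := ℝ) (fun i => pullFactor s i), Fin.prod_univ_two]
  rfl

/-- **The coordinate-`0` distribution function of the box representation is constant from
`x = 1` on** (the window covers the whole box): it equals the value. [folklore] -/
theorem cdfEval_boxRep_of_one_le {s : ℚ} (hs : 0 < s) {x : ℝ} (hx : 1 ≤ x) :
    cdfEval (of (boxRep s hs)) x = (boxRep s hs).value := by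
  rw [cdfEval_of]
  change ∫ z in box ∩ {z : Fin 2 → ℝ | z 0 ≤ x}, boxFun₃ s z = ∫ z in box, boxFun₃ s z
  have hset : box ∩ {z : Fin 2 → ℝ | z 0 ≤ x} = box :=
    inter_eq_left.mpr fun z hz => ((hz 0).2.le.trans hx)
  rw [hset]


/-! ## The exponent `s = 1/3`: the kernel `u^{-2/3}(1-u)^{-1/3}` and its distribution function -/

/-- `0 < 1/3`. [folklore] -/
theorem one_third_pos : (0:ℚ) < 1/3 := by norm_num

/-- The kernel `u^{-2/3}(1−u)^{-1/3}` (= `pullFactor (1/3) 0`). [folklore] -/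
def kern (u : ℝ) : ℝ := u ^ (-(2:ℝ)/3) * (1 - u) ^ (-(1:ℝ)/3)

/-- At `s = 1/3` the first pulled-back factor is the kernel. [folklore] -/
theorem pullFactor_third_zero : pullFactor (1/3) 0 = kern := by
  funext u
  simp only [pullFactor, Matrix.cons_val_zero, kern]
  push_cast
  norm_num

/-- The kernel is integrable on `(0,1)`. [folklore] -/
theorem integrableOn_kern : IntegrableOn kern (Ioo (0:ℝ) 1) := by
  have h := integrable_pullFactor one_third_pos 0
  rw [pullFactor_third_zero] at h
  exact h

/-- The kernel is continuous on `(0,1)`. [folklore] -/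
theorem continuousOn_kern : ContinuousOn kern (Ioo (0:ℝ) 1) := by
  intro u hu
  refine ContinuousAt.continuousWithinAt ?_
  have h1 : ContinuousAt (fun u : ℝ => u ^ (-(2:ℝ)/3)) u :=
    Real.continuousAt_rpow_const _ _ (Or.inl hu.1.ne')
  have h2 : ContinuousAt (fun u : ℝ => (1 - u) ^ (-(1:ℝ)/3)) u :=
    ContinuousAt.rpow_const (continuousAt_const.sub continuousAt_id) (Or.inl (by linarith [hu.2]))
  exact h1.mul h2

/-- The distribution function of the kernel: `J y = ∫_{(0,1) ∩ (−∞, y]} u^{-2/3}(1−u)^{-1/3} du`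
(an incomplete Beta function `B(y; 1/3, 2/3)`). [folklore] -/
def J (y : ℝ) : ℝ := ∫ u in Ioo (0:ℝ) 1 ∩ Iic y, kern u

/-- On `(0,1)` the distribution function is the interval integral from `0`. [folklore] -/
theorem J_eq_intervalIntegral {y : ℝ} (hy : y ∈ Ioo (0:ℝ) 1) : J y = ∫ u in (0:ℝ)..y, kern u := by
  have hset : Ioo (0:ℝ) 1 ∩ Iic y = Ioc 0 y := by
    ext u
    simp only [mem_inter_iff, mem_Ioo, mem_Iic, mem_Ioc]
    constructor
    · rintro ⟨⟨h0, _⟩, h2⟩; exact ⟨h0, h2⟩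
    · rintro ⟨h0, h2⟩; exact ⟨⟨h0, h2.trans_lt hy.2⟩, h2⟩
  rw [J, hset, intervalIntegral.integral_of_le hy.1.le]

/-- **Fundamental theorem of calculus for the distribution function**: `J' = kern` on `(0,1)`.
[folklore] -/
theorem hasDerivAt_J {y : ℝ} (hy : y ∈ Ioo (0:ℝ) 1) : HasDerivAt J (kern y) y := by
  have h1 : HasDerivAt (fun y => ∫ u in (0:ℝ)..y, kern u) (kern y) y := by
    refine intervalIntegral.integral_hasDerivAt_right ?_ ?_ ?_
    · exact (intervalIntegrable_iff_integrableOn_Ioo_of_le hy.1.le).mpr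
        (integrableOn_kern.mono_set (Ioo_subset_Ioo_right hy.2.le))
    · exact continuousOn_kern.stronglyMeasurableAtFilter isOpen_Ioo y hy
    · exact continuousOn_kern.continuousAt (Ioo_mem_nhds hy.1 hy.2)
  refine h1.congr_of_eventuallyEq ?_
  filter_upwards [Ioo_mem_nhds hy.1 hy.2] with y' hy'
  exact J_eq_intervalIntegral hy'

/-- The positive constant `κ = 9·27^{-2/3}·B(1/3,1/3)` multiplying `J(x/3)` in the simplex
distribution function. [folklore] -/
def κ : ℝ := pullConst (1/3) * ∫ v in Ioo (0:ℝ) 1, pullFactor (1/3) 1 v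

/-- `κ > 0`. [folklore] -/
theorem κ_pos : 0 < κ := by
  have hsR : (0:ℝ) < ((1/3 : ℚ) : ℝ) := by push_cast; norm_num
  have hB : ∫ v in Ioo (0:ℝ) 1, pullFactor (1/3) 1 v =
      Gamma ((1/3 : ℚ) : ℝ) * Gamma ((1/3 : ℚ) : ℝ) / Gamma (((1/3 : ℚ) : ℝ) + ((1/3 : ℚ) : ℝ)) :=
    integral_beta hsR hsR
  have hpc : 0 < pullConst (1/3) := by
    unfold pullConst
    positivity
  rw [κ, hB]
  refine mul_pos hpc (div_pos (mul_pos (Gamma_pos_of_pos hsR) (Gamma_pos_of_pos hsR))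
    (Gamma_pos_of_pos (by linarith)))

/-- **The difference of the two distribution functions from `x = 1` on**: with
`V_box = (boxRep 1/3).value`, `(cdf box − cdf simplex)(x) = V_box − κ·J(x/3)` for `x ≥ 1`.
[folklore] -/
theorem cdf_pair_eq {x : ℝ} (hx : 1 ≤ x) :
    (cdfEval (of (boxRep (1/3) one_third_pos)) - cdfEval (of (simplexRep (1/3) one_third_pos))) x =
      (boxRep (1/3) one_third_pos).value - κ * J (x / 3) := by
  rw [Pi.sub_apply, cdfEval_boxRep_of_one_le one_third_pos hx, cdfEval_simplexRep one_third_pos x,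
    pullFactor_third_zero]
  simp only [κ, J]
  ring

/-! ## The rationalising substitution `y = w³/(1+w³)` turns `J` into a logarithmic primitive -/

/-- `X(w) = w³/(1 + w³)`. [folklore] -/
def Xf (w : ℝ) : ℝ := w ^ 3 / (1 + w ^ 3)

/-- `X'(w) = 3w²/(1 + w³)²`. [folklore] -/
def Xf' (w : ℝ) : ℝ := 3 * w ^ 2 / (1 + w ^ 3) ^ 2

/-- `X` maps positives into `(0,1)`. [folklore] -/
theorem Xf_mem_Ioo {w : ℝ} (hw : 0 < w) : Xf w ∈ Ioo (0:ℝ) 1 := by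
  have h1 : 0 < 1 + w ^ 3 := by positivity
  refine ⟨div_pos (by positivity) h1, ?_⟩
  rw [Xf, div_lt_one h1]
  linarith

/-- `X` is monotone on positives. [folklore] -/
theorem Xf_le_Xf {a b : ℝ} (ha : 0 < a) (hab : a ≤ b) : Xf a ≤ Xf b := by
  have hb : 0 < b := ha.trans_le hab
  rw [Xf, Xf, div_le_div_iff₀ (by positivity) (by positivity)]
  have : a ^ 3 ≤ b ^ 3 := pow_le_pow_left₀ ha.le hab 3
  nlinarith

/-- The derivative of `X`. [folklore] -/
theorem hasDerivAt_Xf {w : ℝ} (hw : 0 < w) : HasDerivAt Xf (Xf' w) w := by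
  have h1 : (1 + w ^ 3 : ℝ) ≠ 0 := by positivity
  have hn : HasDerivAt (fun w : ℝ => w ^ 3) (3 * w ^ 2) w := by
    simpa using hasDerivAt_pow 3 w
  have hd : HasDerivAt (fun w : ℝ => 1 + w ^ 3) (3 * w ^ 2) w := by
    simpa using hn.const_add 1
  have h := hn.div hd h1
  refine h.congr_deriv ?_
  rw [Xf']
  field_simp
  ring

/-- **The key algebraic identity of the substitution** (`w > 0`):
`X^{-2/3}(1−X)^{-1/3} · X'(w) = 3/(1 + w³)` — the kernel's pull-back is RATIONAL with the simple
real pole `w = −1` (`∫ 3dw/(1+w³) = log(1+w) − ½log(1−w+w²) + √3·arctan((2w−1)/√3)`). [folklore] -/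
theorem kern_Xf_mul_Xf' {w : ℝ} (hw : 0 < w) : kern (Xf w) * Xf' w = 3 / (1 + w ^ 3) := by
  have h1 : 0 < 1 + w ^ 3 := by positivity
  have hw3 : 0 < w ^ 3 := by positivity
  have e1u : 1 - Xf w = (1 + w ^ 3)⁻¹ := by
    rw [Xf]
    field_simp
    ring
  have e1 : (w ^ 3 : ℝ) ^ (-(2:ℝ)/3) = (w ^ 2)⁻¹ := by
    rw [show (w ^ 3 : ℝ) = w ^ (3:ℝ) by norm_cast, ← Real.rpow_mul hw.le,
      show (3:ℝ) * (-(2:ℝ)/3) = -(2:ℝ) by norm_num, Real.rpow_neg hw.le,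
      show (w ^ (2:ℝ) : ℝ) = w ^ 2 by norm_cast]
  have e2 : ((1 + w ^ 3 : ℝ) ^ (-(2:ℝ)/3))⁻¹ * ((1 + w ^ 3 : ℝ)⁻¹) ^ (-(1:ℝ)/3) = 1 + w ^ 3 := by
    rw [Real.inv_rpow h1.le, ← mul_inv, ← Real.rpow_add h1,
      show (-(2:ℝ)/3 + -(1:ℝ)/3) = -(1:ℝ) by norm_num, Real.rpow_neg_one, inv_inv]
  rw [kern, e1u, Xf, Real.div_rpow hw3.le h1.le, e1, Xf']
  have hw2 : (w ^ 2 : ℝ) ≠ 0 := by positivity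
  have hA : ((1 + w ^ 3 : ℝ) ^ (-(2:ℝ)/3)) ≠ 0 := (Real.rpow_pos_of_pos h1 _).ne'
  calc (w ^ 2)⁻¹ / (1 + w ^ 3) ^ (-(2:ℝ)/3) * ((1 + w ^ 3)⁻¹) ^ (-(1:ℝ)/3) * (3 * w ^ 2 / (1 + w ^ 3) ^ 2)
      = (((1 + w ^ 3 : ℝ) ^ (-(2:ℝ)/3))⁻¹ * ((1 + w ^ 3 : ℝ)⁻¹) ^ (-(1:ℝ)/3)) *
          ((w ^ 2)⁻¹ * (3 * w ^ 2 / (1 + w ^ 3) ^ 2)) := by ring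
    _ = (1 + w ^ 3) * ((w ^ 2)⁻¹ * (3 * w ^ 2 / (1 + w ^ 3) ^ 2)) := by rw [e2]
    _ = 3 / (1 + w ^ 3) := by field_simp


/-! ## The pair `(2, 1/3)` escapes the piecewise class -/

open MvPolynomial in
/-- The closed unit interval as a subset of `ℝ¹` is `ℚ`-semialgebraic. [folklore] -/
theorem isSemialgebraic_unitIcc : IsSemialgebraic ℚ {z : Fin 1 → ℝ | z 0 ∈ Icc (0:ℝ) 1} := by
  have h1 : IsSemialgebraic ℚ {z : Fin 1 → ℝ | 0 ≤ z 0} := by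
    simpa using Literature.ModelTheory.ExponentialFields.isSemialgebraic_setOf_eval_le (k := ℚ)
      (R := ℝ) (0 : MvPolynomial (Fin 1) ℚ) (X 0)
  have h2 : IsSemialgebraic ℚ {z : Fin 1 → ℝ | z 0 ≤ 1} := by
    simpa using Literature.ModelTheory.ExponentialFields.isSemialgebraic_setOf_eval_le (k := ℚ)
      (R := ℝ) (X 0) (1 : MvPolynomial (Fin 1) ℚ)
  convert h1.inter h2 using 1
  ext z
  simp only [mem_setOf_eq, mem_Icc, mem_inter_iff]

open MvPolynomial in
/-- The reparametrised substitution `t ↦ 3·X(w₁ + (w₂ − w₁)t)` is a `ℚ`-semialgebraic map of `ℝ¹`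
on `[0,1]` for rational `0 < w₁ < w₂` (a rational function with positive denominator). [folklore] -/
theorem isSemialgebraicMapOn_subst {w₁ w₂ : ℚ} (hw₁ : 0 < w₁) (hw₁₂ : w₁ < w₂) :
    IsSemialgebraicMapOn ℚ {z : Fin 1 → ℝ | z 0 ∈ Icc (0:ℝ) 1}
      (fun z => fun _ : Fin 1 => 3 * Xf ((w₁:ℝ) + ((w₂:ℝ) - w₁) * z 0)) := by
  set W : MvPolynomial (Fin 1) ℚ := C w₁ + C (w₂ - w₁) * X 0 with hW
  have hWe : ∀ z : Fin 1 → ℝ, aeval z W = (w₁:ℝ) + ((w₂:ℝ) - w₁) * z 0 := by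
    intro z
    simp only [hW, map_add, map_mul, MvPolynomial.aeval_C, MvPolynomial.aeval_X, eq_ratCast]
    push_cast
    ring
  have hpos : ∀ z ∈ {z : Fin 1 → ℝ | z 0 ∈ Icc (0:ℝ) 1}, 0 < (w₁:ℝ) + ((w₂:ℝ) - w₁) * z 0 := by
    intro z hz
    have h0 : (0:ℝ) ≤ z 0 := hz.1
    have hw₁R : (0:ℝ) < w₁ := by exact_mod_cast hw₁
    have hw₁₂R : (w₁:ℝ) < w₂ := by exact_mod_cast hw₁₂
    nlinarith
  have hq : ∀ z ∈ {z : Fin 1 → ℝ | z 0 ∈ Icc (0:ℝ) 1}, aeval z (1 + W ^ 3) ≠ 0 := by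
    intro z hz
    rw [map_add, map_one, map_pow, hWe]
    have := hpos z hz
    positivity
  refine IsSemialgebraicMapOn.of_forall isSemialgebraic_unitIcc fun j => ?_
  refine (isSemialgebraicFunOn_aeval_div_aeval isSemialgebraic_unitIcc (C 3 * W ^ 3) (1 + W ^ 3) hq).congr
    fun z _ => ?_
  simp only [map_add, map_one, map_pow, map_mul, MvPolynomial.aeval_C, eq_ratCast, hWe, Xf]
  push_cast
  ring

open Polynomial in
open scoped Polynomial.Bivariate in
/-- **The `Γ(1/3)³` pair escapes the piecewise class.** The difference of the coordinate-`0`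
distribution functions of the box representation `[(0,1)², v₁^{-2/3}(1−v₁)^{-2/3}v₂^{-1/3}(1−v₂)^{-2/3}]`
and the simplex representation `[{σ > 0, σ₁ + σ₂ < 3}, (σ₁σ₂(3−σ₁−σ₂))^{-2/3}]` (both of value
`B(1/3,1/3)B(2/3,1/3) = Γ(1/3)³`) is NOT piecewise (constant + continuous `ℚ`-semialgebraic): on
`(1, 3)` it is `V_box − κ·B(x/3; 1/3, 2/3)`, and after the rationalising substitution
`x/3 = w³/(1 + w³)` its derivative is `−3κ/(1 + w³) dw` — a rational differential with a simple
real pole (`w = −1`), whose primitives satisfy no polynomial relation `P(w, F(w)) = 0`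
(descent of `Literature.Barriers.…NoSemialgPrimKernel`: "primitives of algebraic functions are
transcendental", here with the logarithm `log(1 + w)`). [cite: KontsevichZagier2001, §1.2] -/
theorem not_isPiecewise_pair :
    ¬ IsPiecewise (cdfEval (of (boxRep (1/3) one_third_pos)) -
      cdfEval (of (simplexRep (1/3) one_third_pos))) := by
  rintro ⟨S, hS⟩
  -- a point of `(1, 3)` off the exceptional set, and its rational neighbourhood inside `[1, 3]`
  obtain ⟨x₀, hx₀, hx₀S⟩ : ∃ x₀ ∈ Ioo (1:ℝ) 3, x₀ ∉ S :=
    (Set.Ioo_infinite (by norm_num : (1:ℝ) < 3)).exists_notMem_finset S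
  obtain ⟨q₁, q₂, hq₁, hq₂, c, g, hg, hgc, hφ⟩ := hS x₀ hx₀S
  set Q₁ : ℚ := max q₁ 1 with hQ₁def
  set Q₂ : ℚ := min q₂ 3 with hQ₂def
  have hQ₁R : ((Q₁:ℚ):ℝ) = max (q₁:ℝ) 1 := by rw [hQ₁def, Rat.cast_max, Rat.cast_one]
  have hQ₂R : ((Q₂:ℚ):ℝ) = min (q₂:ℝ) 3 := by rw [hQ₂def, Rat.cast_min]; norm_num
  have hQ₁x : (Q₁:ℝ) < x₀ := by rw [hQ₁R]; exact max_lt hq₁ hx₀.1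
  have hxQ₂ : x₀ < (Q₂:ℝ) := by rw [hQ₂R]; exact lt_min hq₂ hx₀.2
  have h1Q₁ : (1:ℝ) ≤ Q₁ := by rw [hQ₁R]; exact le_max_right _ _
  have hQ₂3 : (Q₂:ℝ) ≤ 3 := by rw [hQ₂R]; exact min_le_right _ _
  have hQq₁ : (q₁:ℝ) ≤ Q₁ := by rw [hQ₁R]; exact le_max_left _ _
  have hQq₂ : (Q₂:ℝ) ≤ q₂ := by rw [hQ₂R]; exact min_le_left _ _
  -- on `(Q₁, Q₂)`: `Dfun = c + g` and `Dfun = V_box − κ J(·/3)`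
  have hgD : ∀ t ∈ Ioo (Q₁:ℝ) Q₂,
      g (fun _ => t) = (boxRep (1/3) one_third_pos).value - κ * J (t / 3) - c := by
    intro t ht
    have h := hφ t ⟨hQq₁.trans_lt ht.1, ht.2.trans_le hQq₂⟩
    rw [cdf_pair_eq (h1Q₁.trans ht.1.le)] at h
    linarith
  -- rationals `0 < w₁ < w₂` with `Q₁ < 3X(w₁)`, `3X(w₂) < Q₂`
  set U : Set ℝ := {w : ℝ | 0 < w} ∩ ({w : ℝ | (Q₁:ℝ) * (1 + w ^ 3) < 3 * w ^ 3} ∩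
    {w : ℝ | 3 * w ^ 3 < (Q₂:ℝ) * (1 + w ^ 3)}) with hU
  have hUo : IsOpen U := by
    have h1 : IsOpen {w : ℝ | 0 < w} := isOpen_lt continuous_const continuous_id
    have h2 : IsOpen {w : ℝ | (Q₁:ℝ) * (1 + w ^ 3) < 3 * w ^ 3} :=
      isOpen_lt (by fun_prop) (by fun_prop)
    have h3 : IsOpen {w : ℝ | 3 * w ^ 3 < (Q₂:ℝ) * (1 + w ^ 3)} :=
      isOpen_lt (by fun_prop) (by fun_prop)
    exact h1.inter (h2.inter h3)
  have hx3 : 0 < 3 - x₀ := by linarith [hx₀.2]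
  set ρ : ℝ := x₀ / (3 - x₀) with hρ
  have hρpos : 0 < ρ := div_pos (by linarith [hx₀.1]) hx3
  set wstar : ℝ := ρ ^ ((3:ℕ)⁻¹ : ℝ) with hwstar
  have hwstar_pos : 0 < wstar := Real.rpow_pos_of_pos hρpos _
  have hwstar3 : wstar ^ 3 = ρ := by
    rw [hwstar]
    exact Real.rpow_inv_natCast_pow hρpos.le (by norm_num)
  have hwstarU : wstar ∈ U := by
    simp only [hU, mem_inter_iff, mem_setOf_eq]
    refine ⟨hwstar_pos, ?_, ?_⟩
    · rw [hwstar3, hρ]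
      rw [show (Q₁:ℝ) * (1 + x₀ / (3 - x₀)) = (Q₁:ℝ) * 3 / (3 - x₀) by field_simp; ring,
        show (3:ℝ) * (x₀ / (3 - x₀)) = 3 * x₀ / (3 - x₀) by ring,
        div_lt_div_iff_of_pos_right hx3]
      linarith
    · rw [hwstar3, hρ]
      rw [show (Q₂:ℝ) * (1 + x₀ / (3 - x₀)) = (Q₂:ℝ) * 3 / (3 - x₀) by field_simp; ring,
        show (3:ℝ) * (x₀ / (3 - x₀)) = 3 * x₀ / (3 - x₀) by ring,
        div_lt_div_iff_of_pos_right hx3]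
      linarith
  obtain ⟨ε, hε, hball⟩ := Metric.isOpen_iff.mp hUo wstar hwstarU
  obtain ⟨w₁, hw₁l, hw₁r⟩ := exists_rat_btwn (show wstar < wstar + ε / 2 by linarith)
  obtain ⟨w₂, hw₂l, hw₂r⟩ := exists_rat_btwn (show (w₁:ℝ) < wstar + ε / 2 by linarith)
  have hw₁U : (w₁:ℝ) ∈ U := hball (by
    rw [Metric.mem_ball, Real.dist_eq, abs_lt]; constructor <;> linarith)
  have hw₂U : (w₂:ℝ) ∈ U := hball (by
    rw [Metric.mem_ball, Real.dist_eq, abs_lt]; constructor <;> linarith)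
  simp only [hU, mem_inter_iff, mem_setOf_eq] at hw₁U hw₂U
  obtain ⟨hw₁pos, hw₁Q, -⟩ := hw₁U
  obtain ⟨hw₂pos, -, hw₂Q⟩ := hw₂U
  have hw₁posQ : (0:ℚ) < w₁ := by exact_mod_cast hw₁pos
  have hw₁₂Q : w₁ < w₂ := by exact_mod_cast hw₂l
  have hw₁₂ : (w₁:ℝ) < w₂ := hw₂l
  have hXw₁ : (Q₁:ℝ) < 3 * Xf w₁ := by
    rw [Xf, mul_div_assoc', lt_div_iff₀ (by positivity)]
    linarith
  have hXw₂ : 3 * Xf w₂ < (Q₂:ℝ) := by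
    rw [Xf, mul_div_assoc', div_lt_iff₀ (by positivity)]
    linarith
  -- the reparametrisation `w(t) = w₁ + (w₂ − w₁) t`
  set wf : ℝ → ℝ := fun t => (w₁:ℝ) + ((w₂:ℝ) - w₁) * t with hwf
  have hwf_mem : ∀ t ∈ Icc (0:ℝ) 1, (w₁:ℝ) ≤ wf t ∧ wf t ≤ w₂ := by
    intro t ht
    simp only [hwf]
    constructor <;> nlinarith [ht.1, ht.2, hw₁₂]
  have hwf_pos : ∀ t ∈ Icc (0:ℝ) 1, 0 < wf t := fun t ht => hw₁pos.trans_le (hwf_mem t ht).1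
  have hXwf : ∀ t ∈ Icc (0:ℝ) 1, 3 * Xf (wf t) ∈ Ioo (Q₁:ℝ) Q₂ := by
    intro t ht
    obtain ⟨h1, h2⟩ := hwf_mem t ht
    exact ⟨hXw₁.trans_le (by linarith [Xf_le_Xf hw₁pos h1]),
      lt_of_le_of_lt (by linarith [Xf_le_Xf (hwf_pos t ht) h2]) hXw₂⟩
  -- the composite `G = g ∘ (3 X ∘ w)` is `ℚ`-semialgebraic on `[0, 1]`
  set M : (Fin 1 → ℝ) → (Fin 1 → ℝ) := fun z => fun _ => 3 * Xf (wf (z 0)) with hM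
  have hMsa : IsSemialgebraicMapOn ℚ {z : Fin 1 → ℝ | z 0 ∈ Icc (0:ℝ) 1} M :=
    isSemialgebraicMapOn_subst hw₁posQ hw₁₂Q
  have hmaps : MapsTo M {z : Fin 1 → ℝ | z 0 ∈ Icc (0:ℝ) 1} (ivl Q₁ Q₂) :=
    fun z hz => hXwf (z 0) hz
  have hgQ : IsSemialgebraicFunOn ℚ (ivl Q₁ Q₂) g :=
    hg.mono (fun z hz => ⟨hQq₁.trans_lt hz.1, hz.2.trans_le hQq₂⟩) (isSemialgebraic_ivl _ _)
  have hGsa : IsSemialgebraicFunOn ℚ {z : Fin 1 → ℝ | z 0 ∈ Icc (0:ℝ) 1} (g ∘ M) :=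
    IsSemialgebraicFunOn.comp_isSemialgebraicMapOn_holds hgQ hMsa hmaps
  obtain ⟨P, hP0, hPv⟩ :=
    Literature.Barriers.KontsevichZagierPeriods.KZ.NoSemialgPrimKernel.exists_ne_zero_evalEval_eq_zero
      hGsa
  set G : ℝ → ℝ := fun t => (g ∘ M) (fun _ => t) with hG
  -- the derivative of `G` on `(0, 1)`: `−3κ(w₂ − w₁)/(1 + w(t)³)`
  set g' : ℝ → ℝ := fun t => -(3 * κ * ((w₂:ℝ) - w₁)) / (1 + wf t ^ 3) with hg'
  have hGH : ∀ t ∈ Icc (0:ℝ) 1,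
      G t = (boxRep (1/3) one_third_pos).value - c - κ * J (Xf (wf t)) := by
    intro t ht
    have h := hgD (3 * Xf (wf t)) (hXwf t ht)
    simp only [hG, Function.comp_apply, hM] at h ⊢
    rw [h, mul_div_cancel_left₀ _ (three_ne_zero)]
    ring
  have hGder : ∀ t ∈ Ioo (0:ℝ) 1, HasDerivAt G (g' t) t := by
    intro t ht
    have htI : t ∈ Icc (0:ℝ) 1 := Ioo_subset_Icc_self ht
    have hwpos : 0 < wf t := hwf_pos t htI
    have hwfd : HasDerivAt wf ((w₂:ℝ) - w₁) t := by
      have := ((hasDerivAt_id t).const_mul ((w₂:ℝ) - w₁)).const_add (w₁:ℝ)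
      simpa [hwf] using this
    have hXd : HasDerivAt (fun t => Xf (wf t)) (Xf' (wf t) * ((w₂:ℝ) - w₁)) t :=
      (hasDerivAt_Xf hwpos).comp t hwfd
    have hJd := (hasDerivAt_J (Xf_mem_Ioo hwpos)).comp t hXd
    have hHd : HasDerivAt (fun t => (boxRep (1/3) one_third_pos).value - c - κ * J (Xf (wf t)))
        (-(κ * (kern (Xf (wf t)) * (Xf' (wf t) * ((w₂:ℝ) - w₁))))) t :=
      (hJd.const_mul κ).const_sub _
    have hHd' : HasDerivAt (fun t => (boxRep (1/3) one_third_pos).value - c - κ * J (Xf (wf t)))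
        (g' t) t := by
      refine hHd.congr_deriv ?_
      rw [hg', show κ * (kern (Xf (wf t)) * (Xf' (wf t) * ((w₂:ℝ) - w₁))) =
        κ * ((w₂:ℝ) - w₁) * (kern (Xf (wf t)) * Xf' (wf t)) by ring, kern_Xf_mul_Xf' hwpos]
      have : (1 + wf t ^ 3 : ℝ) ≠ 0 := by positivity
      field_simp
    refine hHd'.congr_of_eventuallyEq ?_
    filter_upwards [Ioo_mem_nhds ht.1 ht.2] with t' ht'
    exact hGH t' (Ioo_subset_Icc_self ht')
  -- descent data: `((X − t₀)·V)·g' = N` with the pole `t₀` where `w(t₀) = −1`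
  set t₀ : ℝ := -(1 + (w₁:ℝ)) / ((w₂:ℝ) - w₁) with ht₀
  set Wr : ℝ[X] := C (w₁:ℝ) + C ((w₂:ℝ) - w₁) * X with hWr
  set V : ℝ[X] := C ((w₂:ℝ) - w₁) * (Wr ^ 2 - Wr + 1) with hV
  set N : ℝ[X] := C (-(3 * κ * ((w₂:ℝ) - w₁))) with hN
  have hw₁₂ne : ((w₂:ℝ) - w₁) ≠ 0 := sub_ne_zero.2 (ne_of_gt hw₁₂)
  have hWr_eval : ∀ t, Wr.eval t = wf t := fun t => by
    simp only [hWr, hwf, Polynomial.eval_add, Polynomial.eval_mul, Polynomial.eval_C,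
      Polynomial.eval_X]
  have hlin : ∀ t : ℝ, (t - t₀) * ((w₂:ℝ) - w₁) = wf t + 1 := by
    intro t
    simp only [ht₀, hwf]
    field_simp
    ring
  have hDN : ∀ t ∈ Ioo (0:ℝ) 1, ((X - C t₀) * V).eval t * g' t = N.eval t := by
    intro t ht
    have hwpos : 0 < wf t := hwf_pos t (Ioo_subset_Icc_self ht)
    have hne : (1 + wf t ^ 3 : ℝ) ≠ 0 := by positivity
    have key : ((X - C t₀) * V).eval t = 1 + wf t ^ 3 := by
      simp only [hV, Polynomial.eval_mul, Polynomial.eval_sub, Polynomial.eval_add,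
        Polynomial.eval_pow, Polynomial.eval_X, Polynomial.eval_C, Polynomial.eval_one, hWr_eval]
      calc (t - t₀) * (((w₂:ℝ) - w₁) * (wf t ^ 2 - wf t + 1))
          = ((t - t₀) * ((w₂:ℝ) - w₁)) * (wf t ^ 2 - wf t + 1) := by ring
        _ = (wf t + 1) * (wf t ^ 2 - wf t + 1) := by rw [hlin t]
        _ = 1 + wf t ^ 3 := by ring
    rw [key, hg', hN, Polynomial.eval_C]
    field_simp
  have hwt₀ : wf t₀ = -1 := by
    have := hlin t₀
    simp only [sub_self, zero_mul] at this
    linarith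
  have hVt₀ : V.eval t₀ ≠ 0 := by
    simp only [hV, Polynomial.eval_mul, Polynomial.eval_sub, Polynomial.eval_add,
      Polynomial.eval_pow, Polynomial.eval_C, Polynomial.eval_one, hWr_eval, hwt₀]
    norm_num
    exact hw₁₂ne
  have hNt₀ : N.eval t₀ ≠ 0 := by
    simp only [hN, Polynomial.eval_C, ne_eq, neg_eq_zero]
    have := κ_pos
    positivity
  exact hP0 (Literature.Barriers.KontsevichZagierPeriods.KZ.NoSemialgPrimKernel.eq_zero_of_evalEval_eq_zero
    hGder hDN hVt₀ hNt₀ P.natDegree P le_rfl (fun t ht => hPv t (Ioo_subset_Icc_self ht)))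


/-! ## Consequences for the crux: rule (2) is necessary at `(m, s) = (2, 1/3)` -/

/-- **The `(2, 1/3)` pair is not derivable without a change of variables**: the difference of the
pinned box and simplex representations of `MultiplicationThree/Negative/Pinned.lean` at `s = 1/3`
does not lie in the subgroup generated by the additivity and Newton–Leibniz moves (all dimensions
allowed). [cite: KontsevichZagier2001, §1.2] -/
theorem pair_not_mem_closure_add_nl :
    of (boxRep (1/3) one_third_pos) - of (simplexRep (1/3) one_third_pos) ∉
      AddSubgroup.closure (domainAddRel ∪ integrandAddRel ∪ newtonLeibnizRel) :=
  fun h => not_isPiecewise_pair (isPiecewise_of_mem_closure_add_nl h)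

/-- The distribution function only depends on the domain and the integrand on it. [folklore] -/
theorem cdfEval_congr {n : ℕ} {r₁ r₂ : IntegralRep n} (hd : r₁.domain = r₂.domain)
    (hi : EqOn r₁.integrand r₂.integrand r₁.domain) : cdfEval (of r₁) = cdfEval (of r₂) := by
  funext x
  rw [cdfEval_of, cdfEval_of]
  simp only [hd]
  exact setIntegral_congr_fun ((IntegralRep.measurableSet_domain_holds r₂).inter
    (measurableSet_cdfWindow x n)) fun z hz => hi (hd ▸ hz.1)

/-- Every box representation of the crux at `(2, 1/3)` has the distribution function of the pinned
one. [folklore] -/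
theorem cdfEval_of_isBoxRep {r : IntegralRep 2} (hr : IsBoxRep 2 (1/3) r) :
    cdfEval (of r) = cdfEval (of (boxRep (1/3) one_third_pos)) := by
  refine cdfEval_congr hr.1 fun x hx => ?_
  rw [hr.2 hx]
  change boxFun 2 (1/3) x = boxFun₃ (1/3) x
  simp only [boxFun, Fin.prod_univ_two, Fin.val_zero, Fin.val_one, Nat.cast_zero, Nat.cast_one,
    Nat.cast_ofNat, Summit.KontsevichZagierPeriods.TerasomaMultiplication.MultiplicationThreeNegative.boxFun]
  have h0 : ((0:ℝ) + 1) / (2 + 1) - 1 = -(2:ℝ)/3 := by norm_num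
  have h1 : ((1:ℝ) + 1) / (2 + 1) - 1 = -(1:ℝ)/3 := by norm_num
  rw [h0, h1]
  ring

/-- Every simplex representation of the crux at `(2, 1/3)` has the distribution function of the
pinned one. [folklore] -/
theorem cdfEval_of_isSimplexRep {r' : IntegralRep 2} (hr' : IsSimplexRep 2 (1/3) r') :
    cdfEval (of r') = cdfEval (of (simplexRep (1/3) one_third_pos)) := by
  have hd : r'.domain = (simplexRep (1/3) one_third_pos).domain := by
    rw [hr'.1]
    change simplexDom 2 = triangle
    ext x
    simp only [simplexDom, triangle, mem_setOf_eq, Fin.forall_fin_two, Fin.sum_univ_two,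
      Nat.cast_ofNat]
    constructor
    · rintro ⟨⟨h0, h1⟩, h⟩; exact ⟨h0, h1, by linarith⟩
    · rintro ⟨h0, h1, h⟩; exact ⟨⟨h0, h1⟩, by linarith⟩
  refine cdfEval_congr hd fun x hx => ?_
  rw [hr'.2 hx]
  change simplexFun 2 (1/3) x = simplexFun₃ (1/3) x
  simp only [simplexFun, Fin.prod_univ_two, Fin.sum_univ_two, Nat.cast_ofNat,
    Summit.KontsevichZagierPeriods.TerasomaMultiplication.MultiplicationThreeNegative.simplexFun]
  congr 1
  ring

/-- **Rule (2) is necessary at `(2, 1/3)`, for ANY representatives**: no box/simplex pair of the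
crux at `(m, s) = (2, 1/3)` is connected by additivity and Newton–Leibniz moves alone.
[cite: KontsevichZagier2001, §1.2] -/
theorem not_mem_closure_add_nl_of_reps {r r' : IntegralRep 2} (hr : IsBoxRep 2 (1/3) r)
    (hr' : IsSimplexRep 2 (1/3) r') :
    of r - of r' ∉ AddSubgroup.closure (domainAddRel ∪ integrandAddRel ∪ newtonLeibnizRel) := by
  intro h
  have hp := isPiecewise_of_mem_closure_add_nl h
  rw [cdfEval_of_isBoxRep hr, cdfEval_of_isSimplexRep hr'] at hp
  exact not_isPiecewise_pair hp

/-- STRENGTHENING of the crux (the change-of-variables-free sub-calculus): box ~ simplex by the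
moves (1a), (1b), (3) alone, in all dimensions. Refuted below. -/
def CovFreeVariant : Prop :=
  ∀ (m : ℕ) (s : ℚ), 1 ≤ m → 0 < s → ∀ r r' : IntegralRep m, IsBoxRep m s r → IsSimplexRep m s r' →
    of r - of r' ∈ AddSubgroup.closure (domainAddRel ∪ integrandAddRel ∪ newtonLeibnizRel)

/-- `boxRep 1/3` is a box representation of the crux at `(2, 1/3)`. [folklore] -/
theorem isBoxRep_boxRep_third : IsBoxRep 2 (1/3) (boxRep (1/3) one_third_pos) := by
  refine ⟨rfl, fun x _ => ?_⟩
  change boxFun₃ (1/3) x = boxFun 2 (1/3) x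
  simp only [boxFun, Fin.prod_univ_two, Fin.val_zero, Fin.val_one, Nat.cast_zero, Nat.cast_one,
    Nat.cast_ofNat, Summit.KontsevichZagierPeriods.TerasomaMultiplication.MultiplicationThreeNegative.boxFun]
  have h0 : ((0:ℝ) + 1) / (2 + 1) - 1 = -(2:ℝ)/3 := by norm_num
  have h1 : ((1:ℝ) + 1) / (2 + 1) - 1 = -(1:ℝ)/3 := by norm_num
  rw [h0, h1]
  ring

/-- `simplexRep 1/3` is a simplex representation of the crux at `(2, 1/3)`. [folklore] -/
theorem isSimplexRep_simplexRep_third : IsSimplexRep 2 (1/3) (simplexRep (1/3) one_third_pos) := by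
  refine ⟨?_, fun x _ => ?_⟩
  · change triangle = simplexDom 2
    ext x
    simp only [simplexDom, triangle, mem_setOf_eq, Fin.forall_fin_two, Fin.sum_univ_two,
      Nat.cast_ofNat]
    constructor
    · rintro ⟨h0, h1, h⟩; exact ⟨⟨h0, h1⟩, by linarith⟩
    · rintro ⟨⟨h0, h1⟩, h⟩; exact ⟨h0, h1, by linarith⟩
  · change simplexFun₃ (1/3) x = simplexFun 2 (1/3) x
    simp only [simplexFun, Fin.prod_univ_two, Fin.sum_univ_two, Nat.cast_ofNat,
      Summit.KontsevichZagierPeriods.TerasomaMultiplication.MultiplicationThreeNegative.simplexFun]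
    congr 1
    ring

/-- **The change-of-variables-free strengthening is FALSE** (witness `(m, s) = (2, 1/3)`): every
derivation of the `Γ(1/3)³` pair inside the rules uses rule (2). Contrast: additivity alone is
already insufficient at `(1, 1)` (`Variants.not_byAdditivity`), while `(1, 1)` IS one move of rule
(2) (`OneMove.at_one_one`); here Newton–Leibniz in any number of auxiliary dimensions does not help
either. [cite: KontsevichZagier2001, §1.2] -/
theorem not_covFreeVariant : ¬ CovFreeVariant := fun h =>
  not_mem_closure_add_nl_of_reps isBoxRep_boxRep_third isSimplexRep_simplexRep_third
    (h 2 (1/3) (by norm_num) one_third_pos _ _ isBoxRep_boxRep_third isSimplexRep_simplexRep_third)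


end CovFree

end Summit.KontsevichZagierPeriods.KontsevichZagierPeriods.Cruxes.MultiplicationAccessible.Disproof
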